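import Literature.NumberTheory.Sieve.BombieriFriedlanderIwaniecTheorem7StarSwitch
import HarnessLib

/-!
# Bombieri–Friedlander–Iwaniec 1986, Theorem 7* (§14): the `q ↔ s` switch with the coprimality
condition, and the reduction of the switched congruences to unit classes

Topic `Literature/NumberTheory/Sieve`; continuation of `…Theorem7StarSwitch` (the counting part of
the `q ↔ s` symmetry of BFI §13, p. 241–242: "we are dealing with the equation `mn = a + qrs` … Since
both `q` and `s` are counted with weight 1 they appear symmetrically … Now, we have either `Q²R ≤ x`
or `S²R ≤ x`", which §14 p. 246 invokes for Theorem 7*: "The assumption `Q²R < x` can be removed as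
in Theorem 6").  Everything here is PROVED; no named fact is introduced.

## What is in this file (namespace `Literature.NumberTheory.Sieve.BFI`; everything PROVED)

In `Δ*` (`BFI.deltaStar`) the `q`-sum carries the side condition `(q, al) = 1`.  Under the switch
`q = (lmn − a)/(rs)` the part `(q, l) = 1` is automatic (a common prime of `q` and `l` divides
`lmn − a` and `lmn`, hence `a`: `coprime_mul_iff_of_dvd`), but `(q, a) = 1` is NOT: it becomes a
condition coupling `s` with `lmn`.  We remove it by Möbius inversion over the divisors `d` of `|a|`:
`∑_{q ∈ (Q',2Q'], (q,al)=1} #ρρ{lmn ≡ a (qr)} = ∑_{d ∣ |a|} μ(d) ∑_{s ≤ S} gcount(a; l, l; d r s; window)`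
(`sum_filter_coprime_setCongrCount_eq_moebius_switch`, with the bijection `sum_Ioc_pdiv_dvd_eq`),
where `gcount a z SM SN lc L₀ w lo hi = ∑_{m,n} ρ(m)ρ(n) [w ∣ lc·m·n − a] [lo < L₀·m·n ≤ hi]` is the
generalized switched congruence count (congruence coefficient `lc`, window coefficient `L₀`).
The price is that the switched congruences `lmn ≡ a (mod d r s)` are to NON-unit classes (`d ∣ a`,
and `s` may share primes with `a`).

The second part reduces such counts, prime by prime over `p ∣ a`, to signed bounded combinations
of counts to UNIT classes for the divided variables `m/p^j, n/p^k` (`gcount_step_G`,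
`gcount_step_U`, iterated in `padic_reduction`, output described by `RedProp`): for `p^ω ∥ w`,
`p^α ∥ a`, `p^i ∥ l`,
* `ω ≤ α`: `[lmn ≡ a (p^ω)] = [p^{(ω−i)⁺} ∣ mn]`, expanded by the exact valuation of `n`
  (`pdiv_pow_mul_expand`);
* `ω > α`: `[lmn ≡ a (p^ω)] = ∑_{j+k=α−i} [p^j ∣ m][p^k ∣ n][(l/p^i)(m/p^j)(n/p^k) ≡ a/p^α (p^{ω−α})]`
  (`dind_expand_U`).
After all primes: shift `a/E`, coefficient `l·Dm·Dn/E`, modulus `P·w₀` with `E = Ered`, `P = Pred`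
(products over the primes `p` with `p^{v_p(a)+1} ∥` the `a`-part of the modulus), at most
`∏_p (2v_p(a)+3)` terms, `Dm·Dn ∣ ∏_p p^{v_p(a)+1}`.
The SAME decomposition is proved for the "expected" weights
`P_a(k; w) = E_{u ∈ (ℤ/w)ˣ}[ku ≡ a (w)] = [(k, w) = (a, w)]/φ(w/(a, w))` (`pmodel`, multiplicative in
`w`: `pmodel_mul_of_coprime`; `gmodel`, `gmodel_step_G`, `gmodel_step_U`), which for unit classes is
the weight `[(k, w) = 1]/φ(w)` that `Δ*` subtracts (`gmodel_eq_setCoprimeCount_of_window`); this is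
what makes the main terms of the switched and the unswitched arrangements comparable term by term
(sequel).  Also: grouping `s` by `gcd(s, Θ)` (`sum_Icc_eq_sum_divisors_gcd`), the divided ranges
`sdiv` and the reindexing `sum_sum_pdiv_pdiv`.

## References

* E. Bombieri, J. B. Friedlander, H. Iwaniec, *Primes in arithmetic progressions to large moduli*,
  Acta Math. 156 (1986), 203–251: §13 p. 241–242 ((13.1) and the switch), §14 p. 246.
  [BombieriFriedlanderIwaniecActa1986]
-/

noncomputable section

open Finset Real

open scoped ArithmeticFunction.sigma ArithmeticFunction.Moebius

namespace Literature.NumberTheory.Sieve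

namespace BFI

/-! ### Indicators -/

/-- `[D ∣ x]` as a real number. [folklore] -/
def pdiv (D x : ℕ) : ℝ := if D ∣ x then 1 else 0

/-- `[w ∣ k − a]` (i.e. `k ≡ a (mod w)`) as a real number. [folklore] -/
def dind (w k : ℕ) (a : ℤ) : ℝ := if (w : ℤ) ∣ (k : ℤ) - a then 1 else 0

/-- The window `[lo < k ≤ hi]` as a real number. [folklore] -/
def wind (lo hi : ℤ) (k : ℕ) : ℝ := if lo < (k : ℤ) ∧ (k : ℤ) ≤ hi then 1 else 0

/-- `0 ≤ [D ∣ x]`. [folklore] -/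
theorem pdiv_nonneg (D x : ℕ) : 0 ≤ pdiv D x := by unfold pdiv; split_ifs <;> norm_num
/-- `[D ∣ x] ≤ 1`. [folklore] -/
theorem pdiv_le_one (D x : ℕ) : pdiv D x ≤ 1 := by unfold pdiv; split_ifs <;> norm_num
/-- `0 ≤ [w ∣ k − a]`. [folklore] -/
theorem dind_nonneg (w k : ℕ) (a : ℤ) : 0 ≤ dind w k a := by unfold dind; split_ifs <;> norm_num
/-- `[w ∣ k − a] ≤ 1`. [folklore] -/
theorem dind_le_one (w k : ℕ) (a : ℤ) : dind w k a ≤ 1 := by unfold dind; split_ifs <;> norm_num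
/-- `0 ≤` window indicator. [folklore] -/
theorem wind_nonneg (lo hi : ℤ) (k : ℕ) : 0 ≤ wind lo hi k := by unfold wind; split_ifs <;> norm_num
/-- Window indicator `≤ 1`. [folklore] -/
theorem wind_le_one (lo hi : ℤ) (k : ℕ) : wind lo hi k ≤ 1 := by unfold wind; split_ifs <;> norm_num

/-- `[D ∣ x] = 1` if `D ∣ x`. [folklore] -/
theorem pdiv_of_dvd {D x : ℕ} (h : D ∣ x) : pdiv D x = 1 := by unfold pdiv; rw [if_pos h]
/-- `[D ∣ x] = 0` if `D ∤ x`. [folklore] -/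
theorem pdiv_of_not_dvd {D x : ℕ} (h : ¬ D ∣ x) : pdiv D x = 0 := by unfold pdiv; rw [if_neg h]
/-- `[1 ∣ x] = 1`. [folklore] -/
@[simp] theorem pdiv_one (x : ℕ) : pdiv 1 x = 1 := pdiv_of_dvd (one_dvd x)
/-- `[D ∣ x]` is idempotent. [folklore] -/
theorem pdiv_mul_self (D x : ℕ) : pdiv D x * pdiv D x = pdiv D x := by
  unfold pdiv; split_ifs <;> norm_num

/-- `[D₁D₂ ∣ x] = [D₁ ∣ x][D₂ ∣ x]` for coprime `D₁, D₂`. [folklore] -/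
theorem pdiv_mul_of_coprime {D₁ D₂ : ℕ} (h : D₁.Coprime D₂) (x : ℕ) :
    pdiv (D₁ * D₂) x = pdiv D₁ x * pdiv D₂ x := by
  unfold pdiv
  by_cases h1 : D₁ ∣ x
  · by_cases h2 : D₂ ∣ x
    · rw [if_pos (h.mul_dvd_of_dvd_of_dvd h1 h2), if_pos h1, if_pos h2, mul_one]
    · rw [if_neg (fun h12 => h2 (dvd_trans (dvd_mul_left D₂ D₁) h12)), if_pos h1, if_neg h2, mul_zero]
  · rw [if_neg (fun h12 => h1 (dvd_trans (dvd_mul_right D₁ D₂) h12)), if_neg h1, zero_mul]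

/-- `[w₁w₂ ∣ k − a] = [w₁ ∣ k − a][w₂ ∣ k − a]` for coprime `w₁, w₂`. [folklore] -/
theorem dind_mul_of_coprime {w₁ w₂ : ℕ} (h : w₁.Coprime w₂) (k : ℕ) (a : ℤ) :
    dind (w₁ * w₂) k a = dind w₁ k a * dind w₂ k a := by
  unfold dind
  have hc : IsCoprime (w₁ : ℤ) (w₂ : ℤ) := Nat.isCoprime_iff_coprime.2 h
  by_cases h1 : (w₁ : ℤ) ∣ (k : ℤ) - a
  · by_cases h2 : (w₂ : ℤ) ∣ (k : ℤ) - a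
    · rw [if_pos, if_pos h1, if_pos h2, mul_one]; push_cast; exact hc.mul_dvd h1 h2
    · rw [if_neg, if_pos h1, if_neg h2, mul_zero]
      intro h12; push_cast at h12; exact h2 (dvd_trans (dvd_mul_left _ _) h12)
  · rw [if_neg, if_neg h1, zero_mul]
    intro h12; push_cast at h12; exact h1 (dvd_trans (dvd_mul_right _ _) h12)

/-- If `w ∣ a` then `[w ∣ k − a] = [w ∣ k]`. [folklore] -/
theorem dind_eq_pdiv_of_dvd {w : ℕ} {a : ℤ} (h : (w : ℤ) ∣ a) (k : ℕ) : dind w k a = pdiv w k := by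
  unfold dind pdiv
  have hiff : ((w : ℤ) ∣ (k : ℤ) - a) ↔ w ∣ k := (dvd_sub_left h).trans Int.natCast_dvd_natCast
  simp only [hiff]

/-! ### Valuation bookkeeping -/

/-- `p^ω ∣ lmn ⇔ p^{ω − min(ω, v_p l)} ∣ mn` (for `l, m, n ≥ 1`). [folklore] -/
theorem pow_dvd_mul_mul_iff {p : ℕ} (hp : p.Prime) (ω : ℕ) {l m n : ℕ} (hl : l ≠ 0) (hm : m ≠ 0)
    (hn : n ≠ 0) :
    p ^ ω ∣ l * m * n ↔ p ^ (ω - min ω (padicValNat p l)) ∣ m * n := by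
  haveI := Fact.mk hp
  rw [mul_assoc, padicValNat_dvd_iff_le (mul_ne_zero hl (mul_ne_zero hm hn)),
    padicValNat_dvd_iff_le (mul_ne_zero hm hn), padicValNat.mul hl (mul_ne_zero hm hn)]
  omega

/-- `pdiv` form of `pow_dvd_mul_mul_iff`. [folklore] -/
theorem pdiv_pow_mul_mul {p : ℕ} (hp : p.Prime) (ω : ℕ) {l m n : ℕ} (hl : l ≠ 0) (hm : m ≠ 0)
    (hn : n ≠ 0) :
    pdiv (p ^ ω) (l * m * n) = pdiv (p ^ (ω - min ω (padicValNat p l))) (m * n) := by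
  unfold pdiv
  simp only [pow_dvd_mul_mul_iff hp ω hl hm hn]

/-- **Expansion of `[p^t ∣ mn]` by the exact valuation of `n`**:
`[p^t ∣ mn] = ∑_{j ≤ t} [p^j ∣ n][p^{t−j} ∣ m] − ∑_{j < t} [p^{j+1} ∣ n][p^{t−j} ∣ m]`
(the `j`-th difference is `[v_p(n) = j][p^{t−j} ∣ m]`, and the term `j = t` is `[p^t ∣ n]`). [folklore] -/
theorem pdiv_pow_mul_expand {p : ℕ} (hp : p.Prime) (t : ℕ) {m n : ℕ} (hm : m ≠ 0) (hn : n ≠ 0) :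
    pdiv (p ^ t) (m * n) =
      ∑ j ∈ range (t + 1), pdiv (p ^ j) n * pdiv (p ^ (t - j)) m -
        ∑ j ∈ range t, pdiv (p ^ (j + 1)) n * pdiv (p ^ (t - j)) m := by
  haveI := Fact.mk hp
  set vn := padicValNat p n with hvn
  set vm := padicValNat p m with hvm
  have hdn : ∀ j, pdiv (p ^ j) n = if j ≤ vn then 1 else 0 := by
    intro j; unfold pdiv; simp only [padicValNat_dvd_iff_le hn, hvn]
  have hdm : ∀ j, pdiv (p ^ j) m = if j ≤ vm then 1 else 0 := by
    intro j; unfold pdiv; simp only [padicValNat_dvd_iff_le hm, hvm]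
  have hmn : pdiv (p ^ t) (m * n) = if t ≤ vm + vn then 1 else 0 := by
    unfold pdiv; simp only [padicValNat_dvd_iff_le (mul_ne_zero hm hn), padicValNat.mul hm hn, hvm, hvn]
  -- split off the term `j = t` of the first sum and pair the rest
  rw [Finset.sum_range_succ, Nat.sub_self, pow_zero, pdiv_one, mul_one, add_sub_right_comm,
    ← Finset.sum_sub_distrib]
  have hpair : ∀ j ∈ range t, pdiv (p ^ j) n * pdiv (p ^ (t - j)) m -
      pdiv (p ^ (j + 1)) n * pdiv (p ^ (t - j)) m = if j = vn then pdiv (p ^ (t - j)) m else 0 := by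
    intro j _
    rw [hdn j, hdn (j + 1)]
    by_cases hj : j = vn
    · subst hj; simp
    · by_cases hj' : j ≤ vn
      · have : j + 1 ≤ vn := by omega
        rw [if_pos hj', if_pos this, if_neg hj]; ring
      · have : ¬ j + 1 ≤ vn := by omega
        rw [if_neg hj', if_neg this, if_neg hj]; ring
  rw [Finset.sum_congr rfl hpair, Finset.sum_ite_eq' (range t) vn, hdn t, hmn]
  by_cases hvnt : vn < t
  · rw [if_pos (Finset.mem_range.2 hvnt), hdm, if_neg (not_le.2 hvnt), add_zero]
    by_cases h : t ≤ vm + vn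
    · rw [if_pos h, if_pos (by omega)]
    · rw [if_neg h, if_neg (by omega)]
  · rw [if_neg (fun h => hvnt (Finset.mem_range.1 h)), zero_add]
    push Not at hvnt
    rw [if_pos hvnt, if_pos (by omega)]

/-- If `p^ω ∣ lmn − a` with `ω > α = v_p(a)` (`a ≠ 0`), then `v_p(lmn) = α` exactly. [folklore] -/
theorem padicValNat_eq_of_pow_dvd_sub {p : ℕ} (hp : p.Prime) {a : ℤ} (ha : a ≠ 0) {ω : ℕ}
    (hω : padicValNat p a.natAbs < ω) {k : ℕ} (hk : k ≠ 0) (hdvd : (p : ℤ) ^ ω ∣ (k : ℤ) - a) :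
    padicValNat p k = padicValNat p a.natAbs := by
  haveI := Fact.mk hp
  set α := padicValNat p a.natAbs with hα
  have haN : a.natAbs ≠ 0 := Int.natAbs_ne_zero.2 ha
  -- `p^{α+1} ∤ a`, `p^α ∣ a`
  have hnot : ¬ p ^ (α + 1) ∣ a.natAbs := pow_succ_padicValNat_not_dvd haN
  have hpa : (p : ℤ) ^ α ∣ a := by
    rw [← Int.natAbs_dvd_natAbs]; simp only [Int.natAbs_pow, Int.natAbs_natCast]
    exact pow_padicValNat_dvd
  by_contra hne
  rcases lt_or_gt_of_ne hne with hlt | hgt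
  · -- `v_p(k) < α`: then `p^{v+1} ∣ a` and `p^{v+1} ∣ k − a` force `p^{v+1} ∣ k`
    set v := padicValNat p k
    have h1 : (p : ℤ) ^ (v + 1) ∣ a := by
      have : (p : ℤ) ^ (v + 1) ∣ (p : ℤ) ^ α := pow_dvd_pow _ (by omega)
      exact this.trans hpa
    have h2 : (p : ℤ) ^ (v + 1) ∣ (k : ℤ) - a := (pow_dvd_pow _ (by omega)).trans hdvd
    have h3 : (p : ℤ) ^ (v + 1) ∣ (k : ℤ) := by
      have := dvd_add h2 h1; rwa [sub_add_cancel] at this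
    have h4 : p ^ (v + 1) ∣ k := by exact_mod_cast h3
    exact pow_succ_padicValNat_not_dvd hk h4
  · -- `v_p(k) > α`: then `p^{α+1} ∣ k` and `p^{α+1} ∣ k − a` force `p^{α+1} ∣ a`
    have h1 : (p : ℤ) ^ (α + 1) ∣ (k : ℤ) := by
      have : p ^ (α + 1) ∣ k := (padicValNat_dvd_iff_le hk).2 (by omega)
      exact_mod_cast this
    have h2 : (p : ℤ) ^ (α + 1) ∣ (k : ℤ) - a := (pow_dvd_pow _ (by omega)).trans hdvd
    have h3 : (p : ℤ) ^ (α + 1) ∣ a := by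
      have := dvd_sub h1 h2; rwa [sub_sub_cancel] at this
    apply hnot
    rw [← Int.natAbs_dvd_natAbs] at h3
    simpa [Int.natAbs_pow, Int.natAbs_natCast] using h3


/-! ### The data of the `p`-adic reduction at a prime `p ∣ a` with `p^ω ∥ w`, `ω > v_p(a)` -/

/-- `gcd(x, p^ω) = p^{min(v_p x, ω)}` for `x ≠ 0`. [folklore] -/
theorem gcd_prime_pow_eq {p : ℕ} (hp : p.Prime) {x : ℕ} (hx : x ≠ 0) (ω : ℕ) :
    Nat.gcd x (p ^ ω) = p ^ min (padicValNat p x) ω := by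
  haveI := Fact.mk hp
  obtain ⟨e, he, hge⟩ := (Nat.dvd_prime_pow hp).1 (Nat.gcd_dvd_right x (p ^ ω))
  rw [hge]
  congr 1
  apply le_antisymm
  · have h1 : p ^ e ∣ x := hge ▸ Nat.gcd_dvd_left x (p ^ ω)
    have := (padicValNat_dvd_iff_le hx).1 h1
    exact le_min this he
  · have h2 : p ^ min (padicValNat p x) ω ∣ Nat.gcd x (p ^ ω) :=
      Nat.dvd_gcd ((pow_dvd_pow p (min_le_left _ _)).trans pow_padicValNat_dvd)
        (pow_dvd_pow p (min_le_right _ _))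
    rw [hge, Nat.pow_dvd_pow_iff_le_right hp.one_lt] at h2
    exact h2

/-- `a = p^α · (a / p^α)` with `p ∤ a/p^α`, `α = v_p(a)`, `a ≠ 0`. [folklore] -/
theorem int_eq_pow_mul_div_padic {p : ℕ} (hp : p.Prime) {a : ℤ} (ha : a ≠ 0) :
    a = (p : ℤ) ^ padicValNat p a.natAbs * (a / (p : ℤ) ^ padicValNat p a.natAbs) ∧
      ¬ (p : ℤ) ∣ a / (p : ℤ) ^ padicValNat p a.natAbs := by
  haveI := Fact.mk hp
  set α := padicValNat p a.natAbs with hα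
  have haN : a.natAbs ≠ 0 := Int.natAbs_ne_zero.2 ha
  have hpa : (p : ℤ) ^ α ∣ a := by
    rw [← Int.natAbs_dvd_natAbs]; simp only [Int.natAbs_pow, Int.natAbs_natCast]
    exact pow_padicValNat_dvd
  refine ⟨(Int.mul_ediv_cancel' hpa).symm, fun h => ?_⟩
  have : (p : ℤ) ^ (α + 1) ∣ a := by
    rw [(Int.mul_ediv_cancel' hpa).symm, pow_succ]
    exact mul_dvd_mul_left _ h
  apply pow_succ_padicValNat_not_dvd (p := p) haN
  rw [← Int.natAbs_dvd_natAbs] at this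
  simpa [Int.natAbs_pow, Int.natAbs_natCast] using this

/-- `x = p^j · (x / p^j)` and `v_p(x / p^j) = v_p(x) − j` when `p^j ∣ x ≠ 0`. [folklore] -/
theorem padicValNat_div_pow_eq {p : ℕ} (hp : p.Prime) {x j : ℕ} (hx : x ≠ 0) (h : p ^ j ∣ x) :
    x / p ^ j ≠ 0 ∧ padicValNat p (x / p ^ j) = padicValNat p x - j := by
  haveI := Fact.mk hp
  refine ⟨?_, padicValNat.div_pow h⟩
  intro h0
  have := Nat.div_mul_cancel h
  rw [h0, zero_mul] at this
  exact hx this.symm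

/-- **The combinatorial core of the case `ω > α`.**  For `l, m, n ≥ 1`, `α = v_p(a) ≥ i = v_p(l)`,
and `j ≤ α − i`: if `p^j ∣ m` and `p^{α−i−j} ∣ n` then `v_p(lmn) ≥ α`, the divided product
`(l/p^i)(m/p^j)(n/p^{α−i−j})` has valuation `v_p(lmn) − α`, and `lmn = p^α · (divided product)`.
[folklore] -/
theorem core_U {p : ℕ} (hp : p.Prime) {l m n i α j : ℕ} (hl : l ≠ 0) (hm : m ≠ 0) (hn : n ≠ 0)
    (hi : padicValNat p l = i) (hiα : i ≤ α) (hj : j ≤ α - i) (hjm : p ^ j ∣ m)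
    (hjn : p ^ (α - i - j) ∣ n) :
    α ≤ padicValNat p (l * m * n) ∧
      l / p ^ i * (m / p ^ j) * (n / p ^ (α - i - j)) ≠ 0 ∧
      padicValNat p (l / p ^ i * (m / p ^ j) * (n / p ^ (α - i - j))) =
        padicValNat p (l * m * n) - α ∧
      l * m * n = p ^ α * (l / p ^ i * (m / p ^ j) * (n / p ^ (α - i - j))) := by
  haveI := Fact.mk hp
  have hil : p ^ i ∣ l := hi ▸ pow_padicValNat_dvd
  obtain ⟨hl', hvl'⟩ := padicValNat_div_pow_eq hp hl hil
  obtain ⟨hm', hvm'⟩ := padicValNat_div_pow_eq hp hm hjm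
  obtain ⟨hn', hvn'⟩ := padicValNat_div_pow_eq hp hn hjn
  have hvm : j ≤ padicValNat p m := (padicValNat_dvd_iff_le hm).1 hjm
  have hvn : α - i - j ≤ padicValNat p n := (padicValNat_dvd_iff_le hn).1 hjn
  have hvlmn : padicValNat p (l * m * n) = padicValNat p l + padicValNat p m + padicValNat p n := by
    rw [padicValNat.mul (mul_ne_zero hl hm) hn, padicValNat.mul hl hm]
  have hprod : l * m * n = p ^ α * (l / p ^ i * (m / p ^ j) * (n / p ^ (α - i - j))) := by
    have e1 := Nat.div_mul_cancel hil
    have e2 := Nat.div_mul_cancel hjm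
    have e3 := Nat.div_mul_cancel hjn
    have hpow : p ^ α = p ^ i * p ^ j * p ^ (α - i - j) := by
      rw [← pow_add, ← pow_add]; congr 1; omega
    calc l * m * n = (l / p ^ i * p ^ i) * (m / p ^ j * p ^ j) * (n / p ^ (α - i - j) * p ^ (α - i - j)) := by
          rw [e1, e2, e3]
      _ = p ^ α * (l / p ^ i * (m / p ^ j) * (n / p ^ (α - i - j))) := by rw [hpow]; ring
  refine ⟨by rw [hvlmn]; omega, mul_ne_zero (mul_ne_zero hl' hm') hn', ?_, hprod⟩
  rw [padicValNat.mul (mul_ne_zero hl' hm') hn', padicValNat.mul hl' hm', hvl', hvm', hvn', hvlmn]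
  omega

/-- In the case `ω > α`: if `v_p(lmn) = α` then exactly the index `j = v_p(m)` has
`p^j ∣ m ∧ p^{α−i−j} ∣ n`. [folklore] -/
theorem present_iff_of_eq {p : ℕ} (hp : p.Prime) {l m n i α j : ℕ} (hl : l ≠ 0) (hm : m ≠ 0)
    (hn : n ≠ 0) (hi : padicValNat p l = i) (hlmn : padicValNat p (l * m * n) = α) :
    (p ^ j ∣ m ∧ p ^ (α - i - j) ∣ n) ↔ j = padicValNat p m := by
  haveI := Fact.mk hp
  have hvlmn : padicValNat p (l * m * n) = padicValNat p l + padicValNat p m + padicValNat p n := by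
    rw [padicValNat.mul (mul_ne_zero hl hm) hn, padicValNat.mul hl hm]
  rw [padicValNat_dvd_iff_le hm, padicValNat_dvd_iff_le hn]
  omega

/-! ### The expected weight `P_a(k; w) = [(k, w) = (a, w)] / φ(w/(a, w))` -/

/-- **The model weight** `P_a(k; w) := [(k, w) = (a, w)] · φ(w/(a, w))⁻¹`: the probability that
`k·u ≡ a (mod w)` for a uniformly random unit `u (mod w)`.  For `(a, w) = 1` it is
`[(k, w) = 1]/φ(w)`, the "expected value" of `[k ≡ a (mod w)]` that `Δ*` subtracts. [folklore] -/
def pmodel (a : ℤ) (k w : ℕ) : ℝ :=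
  if Nat.gcd k w = Nat.gcd a.natAbs w then ((Nat.totient (w / Nat.gcd a.natAbs w) : ℕ) : ℝ)⁻¹ else 0

/-- `P_a(k; w) ≥ 0`. [folklore] -/
theorem pmodel_nonneg (a : ℤ) (k w : ℕ) : 0 ≤ pmodel a k w := by
  unfold pmodel; split_ifs <;> positivity

/-- For `(a, w) = 1`: `P_a(k; w) = [(k, w) = 1]/φ(w)`. [folklore] -/
theorem pmodel_of_coprime {a : ℤ} {w : ℕ} (h : Nat.Coprime a.natAbs w) (k : ℕ) :
    pmodel a k w = if k.Coprime w then ((Nat.totient w : ℕ) : ℝ)⁻¹ else 0 := by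
  unfold pmodel
  rw [Nat.Coprime] at h
  rw [h, Nat.div_one]

/-- A product equality of divisors of coprime numbers splits. [folklore] -/
theorem eq_and_eq_of_mul_eq_mul_of_dvd {w₁ w₂ h₁ h₂ g₁ g₂ : ℕ} (hw : w₁.Coprime w₂)
    (hh₁ : h₁ ∣ w₁) (hh₂ : h₂ ∣ w₂) (hg₁ : g₁ ∣ w₁) (hg₂ : g₂ ∣ w₂) (he : h₁ * h₂ = g₁ * g₂) :
    h₁ = g₁ ∧ h₂ = g₂ := by
  have c1 : Nat.gcd (h₁ * h₂) w₁ = h₁ := by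
    rw [Nat.Coprime.gcd_mul_right_cancel h₁ ((hw.symm.coprime_dvd_left hh₂))]
    exact Nat.gcd_eq_left hh₁
  have c2 : Nat.gcd (g₁ * g₂) w₁ = g₁ := by
    rw [Nat.Coprime.gcd_mul_right_cancel g₁ ((hw.symm.coprime_dvd_left hg₂))]
    exact Nat.gcd_eq_left hg₁
  have c3 : Nat.gcd (h₁ * h₂) w₂ = h₂ := by
    rw [mul_comm, Nat.Coprime.gcd_mul_right_cancel h₂ ((hw.coprime_dvd_left hh₁))]
    exact Nat.gcd_eq_left hh₂
  have c4 : Nat.gcd (g₁ * g₂) w₂ = g₂ := by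
    rw [mul_comm, Nat.Coprime.gcd_mul_right_cancel g₂ ((hw.coprime_dvd_left hg₁))]
    exact Nat.gcd_eq_left hg₂
  constructor
  · rw [← c1, he, c2]
  · rw [← c3, he, c4]

/-- **`P_a(k; ·)` is multiplicative**: `P_a(k; w₁w₂) = P_a(k; w₁) P_a(k; w₂)` for coprime `w₁, w₂`.
[folklore] -/
theorem pmodel_mul_of_coprime (a : ℤ) (k : ℕ) {w₁ w₂ : ℕ} (hw : w₁.Coprime w₂) :
    pmodel a k (w₁ * w₂) = pmodel a k w₁ * pmodel a k w₂ := by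
  unfold pmodel
  set A := a.natAbs
  rw [Nat.Coprime.gcd_mul k hw, Nat.Coprime.gcd_mul A hw]
  by_cases h1 : Nat.gcd k w₁ = Nat.gcd A w₁
  · by_cases h2 : Nat.gcd k w₂ = Nat.gcd A w₂
    · rw [if_pos (by rw [h1, h2]), if_pos h1, if_pos h2]
      have hd : w₁ * w₂ / (Nat.gcd A w₁ * Nat.gcd A w₂) = (w₁ / Nat.gcd A w₁) * (w₂ / Nat.gcd A w₂) :=
        Nat.mul_div_mul_comm (Nat.gcd_dvd_right A w₁) (Nat.gcd_dvd_right A w₂)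
      have hc : (w₁ / Nat.gcd A w₁).Coprime (w₂ / Nat.gcd A w₂) :=
        Nat.Coprime.coprime_dvd_left (Nat.div_dvd_of_dvd (Nat.gcd_dvd_right A w₁))
          (Nat.Coprime.coprime_dvd_right (Nat.div_dvd_of_dvd (Nat.gcd_dvd_right A w₂)) hw)
      rw [hd, Nat.totient_mul hc, Nat.cast_mul, mul_inv]
    · rw [if_neg, if_neg h2, mul_zero]
      intro he
      exact h2 (eq_and_eq_of_mul_eq_mul_of_dvd hw (Nat.gcd_dvd_right k w₁) (Nat.gcd_dvd_right k w₂)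
        (Nat.gcd_dvd_right A w₁) (Nat.gcd_dvd_right A w₂) he).2
  · rw [if_neg, if_neg h1, zero_mul]
    intro he
    exact h1 (eq_and_eq_of_mul_eq_mul_of_dvd hw (Nat.gcd_dvd_right k w₁) (Nat.gcd_dvd_right k w₂)
      (Nat.gcd_dvd_right A w₁) (Nat.gcd_dvd_right A w₂) he).1



/-- **`P_a(k; p^ω)` for `p^ω ∣ a`** (i.e. `ω ≤ v_p(a)`): `= [p^ω ∣ k]`. [folklore] -/
theorem pmodel_prime_pow_of_dvd {p : ℕ} (hp : p.Prime) {a : ℤ} {ω : ℕ} (h : p ^ ω ∣ a.natAbs)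
    (k : ℕ) : pmodel a k (p ^ ω) = pdiv (p ^ ω) k := by
  unfold pmodel pdiv
  have hpos : 0 < p ^ ω := pow_pos hp.pos ω
  rw [Nat.gcd_eq_right h, Nat.div_self hpos, Nat.totient_one, Nat.cast_one, inv_one]
  simp only [Nat.gcd_eq_right_iff_dvd]

/-- **`P_a(k; p^ω)` for `ω > α = v_p(a)`** (`a, k ≠ 0`): `= [v_p(k) = α] / φ(p^{ω−α})`. [folklore] -/
theorem pmodel_prime_pow_of_lt {p : ℕ} (hp : p.Prime) {a : ℤ} (ha : a ≠ 0) {ω : ℕ}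
    (hω : padicValNat p a.natAbs < ω) {k : ℕ} (hk : k ≠ 0) :
    pmodel a k (p ^ ω) =
      if padicValNat p k = padicValNat p a.natAbs
      then ((Nat.totient (p ^ (ω - padicValNat p a.natAbs)) : ℕ) : ℝ)⁻¹ else 0 := by
  unfold pmodel
  set α := padicValNat p a.natAbs
  have haN : a.natAbs ≠ 0 := Int.natAbs_ne_zero.2 ha
  rw [gcd_prime_pow_eq hp hk, gcd_prime_pow_eq hp haN, min_eq_left hω.le,
    Nat.pow_div hω.le hp.pos]
  have hinj : ∀ u v : ℕ, p ^ u = p ^ v ↔ u = v := fun u v =>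
    (Nat.pow_right_injective hp.two_le).eq_iff
  simp only [hinj]
  by_cases hv : padicValNat p k = α
  · rw [if_pos (by rw [hv]; exact min_eq_left hω.le), if_pos hv]
  · rw [if_neg, if_neg hv]
    intro hmin
    rcases min_choice (padicValNat p k) ω with h1 | h1 <;> rw [h1] at hmin <;> omega

/-! ### The pointwise reduction at one prime, case `ω > α` -/

/-- **Case `ω > α`, congruence indicator.**  For `ω > α = v_p(a)`, `i = v_p(l) ≤ α` (any `w'`):
`[p^ω w' ∣ lmn − a] = ∑_{j ≤ α−i} [p^j ∣ m][p^{α−i−j} ∣ n]·[p^{ω−α} w' ∣ (l/p^i)(m/p^j)(n/p^{α−i−j}) − a/p^α]`.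
[cite: BombieriFriedlanderIwaniecActa1986, §13 p. 241–242] -/
theorem dind_expand_U {p : ℕ} (hp : p.Prime) {a : ℤ} (ha : a ≠ 0) {ω : ℕ}
    (hω : padicValNat p a.natAbs < ω) (w' : ℕ) {l m n : ℕ}
    (hl : l ≠ 0) (hm : m ≠ 0) (hn : n ≠ 0) (hi : padicValNat p l ≤ padicValNat p a.natAbs) :
    dind (p ^ ω * w') (l * m * n) a =
      ∑ j ∈ range (padicValNat p a.natAbs - padicValNat p l + 1),
        pdiv (p ^ j) m * pdiv (p ^ (padicValNat p a.natAbs - padicValNat p l - j)) n *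
          dind (p ^ (ω - padicValNat p a.natAbs) * w')
            (l / p ^ padicValNat p l * (m / p ^ j) *
              (n / p ^ (padicValNat p a.natAbs - padicValNat p l - j)))
            (a / (p : ℤ) ^ padicValNat p a.natAbs) := by
  haveI := Fact.mk hp
  set α := padicValNat p a.natAbs with hα
  set i := padicValNat p l with hi'
  obtain ⟨hadec, hpa'⟩ := int_eq_pow_mul_div_padic hp ha
  set a' := a / (p : ℤ) ^ α with ha'
  have hpωpos : (p : ℤ) ^ α ≠ 0 := pow_ne_zero _ (by exact_mod_cast hp.ne_zero)
  -- the value of a generic term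
  have hterm : ∀ j ∈ range (α - i + 1), p ^ j ∣ m → p ^ (α - i - j) ∣ n →
      dind (p ^ (ω - α) * w') (l / p ^ i * (m / p ^ j) * (n / p ^ (α - i - j))) a' =
        if padicValNat p (l * m * n) = α then dind (p ^ ω * w') (l * m * n) a else 0 := by
    intro j hj hjm hjn
    have hjle : j ≤ α - i := by have := Finset.mem_range.1 hj; omega
    obtain ⟨hge, hk0, hvk, hprod⟩ := core_U hp hl hm hn hi'.symm hi hjle hjm hjn
    set k' := l / p ^ i * (m / p ^ j) * (n / p ^ (α - i - j))
    by_cases hlam : padicValNat p (l * m * n) = α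
    · rw [if_pos hlam]
      -- `lmn − a = p^α (k' − a')` and `p^ω w' = p^α (p^{ω−α} w')`
      unfold dind
      have e1 : ((l * m * n : ℕ) : ℤ) - a = (p : ℤ) ^ α * ((k' : ℤ) - a') := by
        rw [hprod]; push_cast; rw [mul_sub, ← hadec]
      have e2 : ((p ^ ω * w' : ℕ) : ℤ) = (p : ℤ) ^ α * ((p ^ (ω - α) * w' : ℕ) : ℤ) := by
        push_cast; rw [← mul_assoc, ← pow_add]; congr 2; omega
      simp only [e1, e2, mul_dvd_mul_iff_left hpωpos]
    · rw [if_neg hlam]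
      -- the divided product is divisible by `p`, `a'` is not, and `p ∣ p^{ω−α} w'`
      have hvpos : 0 < padicValNat p k' := by rw [hvk]; omega
      have hpk' : p ∣ k' := dvd_of_one_le_padicValNat hvpos
      unfold dind
      rw [if_neg]
      intro hd
      have hp1 : (p : ℤ) ∣ ((p ^ (ω - α) * w' : ℕ) : ℤ) := by
        push_cast
        exact Dvd.dvd.mul_right (dvd_pow_self _ (by omega)) _
      have h2 : (p : ℤ) ∣ (k' : ℤ) - a' := hp1.trans hd
      have h3 : (p : ℤ) ∣ (k' : ℤ) := by exact_mod_cast hpk'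
      have h4 : (p : ℤ) ∣ a' := by have := dvd_sub h3 h2; rwa [sub_sub_cancel] at this
      exact hpa' h4
  -- evaluate the sum
  by_cases hlam : padicValNat p (l * m * n) = α
  · -- exactly the term `j = v_p(m)` is present
    have hvmem : padicValNat p m ∈ range (α - i + 1) := by
      have hvlmn : padicValNat p (l * m * n) = padicValNat p l + padicValNat p m + padicValNat p n := by
        rw [padicValNat.mul (mul_ne_zero hl hm) hn, padicValNat.mul hl hm]
      rw [Finset.mem_range]; omega
    rw [Finset.sum_eq_single_of_mem (padicValNat p m) hvmem]
    · have hpres := (present_iff_of_eq (j := padicValNat p m) hp hl hm hn hi'.symm hlam).2 rfl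
      rw [pdiv_of_dvd hpres.1, pdiv_of_dvd hpres.2, one_mul, one_mul,
        hterm _ hvmem hpres.1 hpres.2, if_pos hlam]
    · intro j hj hne
      by_cases hjm : p ^ j ∣ m
      · by_cases hjn : p ^ (α - i - j) ∣ n
        · exact absurd ((present_iff_of_eq hp hl hm hn hi'.symm hlam).1 ⟨hjm, hjn⟩) hne
        · rw [pdiv_of_not_dvd hjn, mul_zero, zero_mul]
      · rw [pdiv_of_not_dvd hjm, zero_mul, zero_mul]
  · -- no term is present with a nonzero value, and the left side vanishes
    have hL : dind (p ^ ω * w') (l * m * n) a = 0 := by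
      unfold dind; rw [if_neg]
      intro hd
      apply hlam
      refine padicValNat_eq_of_pow_dvd_sub hp ha hω (mul_ne_zero (mul_ne_zero hl hm) hn) ?_
      have : ((p : ℤ) ^ ω) ∣ ((p ^ ω * w' : ℕ) : ℤ) := by push_cast; exact dvd_mul_right _ _
      exact this.trans hd
    rw [hL]
    symm
    refine Finset.sum_eq_zero fun j hj => ?_
    by_cases hjm : p ^ j ∣ m
    · by_cases hjn : p ^ (α - i - j) ∣ n
      · rw [hterm j hj hjm hjn, if_neg hlam, mul_zero]
      · rw [pdiv_of_not_dvd hjn, mul_zero, zero_mul]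
    · rw [pdiv_of_not_dvd hjm, zero_mul, zero_mul]

/-- In the case `ω > α` with `v_p(l) > α` the congruence has no solutions. [folklore] -/
theorem dind_eq_zero_of_lt_padicValNat {p : ℕ} (hp : p.Prime) {a : ℤ} (ha : a ≠ 0) {ω : ℕ}
    (hω : padicValNat p a.natAbs < ω) (w' : ℕ) {l m n : ℕ} (hl : l ≠ 0) (hm : m ≠ 0)
    (hn : n ≠ 0) (hi : padicValNat p a.natAbs < padicValNat p l) :
    dind (p ^ ω * w') (l * m * n) a = 0 := by
  haveI := Fact.mk hp
  unfold dind; rw [if_neg]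
  intro hd
  have hv := padicValNat_eq_of_pow_dvd_sub hp ha hω (mul_ne_zero (mul_ne_zero hl hm) hn)
    ((show ((p : ℤ) ^ ω) ∣ ((p ^ ω * w' : ℕ) : ℤ) by push_cast; exact dvd_mul_right _ _).trans hd)
  have hvlmn : padicValNat p (l * m * n) = padicValNat p l + padicValNat p m + padicValNat p n := by
    rw [padicValNat.mul (mul_ne_zero hl hm) hn, padicValNat.mul hl hm]
  omega


/-- `a / p^α ≠ 0`, `v_p(a / p^α) = 0` and `|a| = p^α |a / p^α|` for `α = v_p(a)`, `a ≠ 0`. [folklore] -/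
theorem div_padic_facts {p : ℕ} (hp : p.Prime) {a : ℤ} (ha : a ≠ 0) :
    a / (p : ℤ) ^ padicValNat p a.natAbs ≠ 0 ∧
      padicValNat p (a / (p : ℤ) ^ padicValNat p a.natAbs).natAbs = 0 ∧
      a.natAbs = p ^ padicValNat p a.natAbs * (a / (p : ℤ) ^ padicValNat p a.natAbs).natAbs := by
  haveI := Fact.mk hp
  obtain ⟨hadec, hpa'⟩ := int_eq_pow_mul_div_padic hp ha
  set a' := a / (p : ℤ) ^ padicValNat p a.natAbs
  refine ⟨fun h0 => ha (by rw [hadec, h0, mul_zero]), ?_, ?_⟩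
  · rw [padicValNat.eq_zero_iff]
    right; right
    intro h
    exact hpa' (Int.ofNat_dvd_left.2 h)
  · conv_lhs => rw [hadec]
    rw [Int.natAbs_mul, Int.natAbs_pow, Int.natAbs_natCast]

/-- **Case `ω > α`, model weight.**  For `p ∤ w'`, `ω > α = v_p(a)`, `i = v_p(l) ≤ α`:
`P_a(lmn; p^ω w') = ∑_{j ≤ α−i} [p^j ∣ m][p^{α−i−j} ∣ n]·P_{a/p^α}((l/p^i)(m/p^j)(n/p^{α−i−j}); p^{ω−α} w')`.
[folklore] -/
theorem pmodel_expand_U {p : ℕ} (hp : p.Prime) {a : ℤ} (ha : a ≠ 0) {ω : ℕ}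
    (hω : padicValNat p a.natAbs < ω) {w' : ℕ} (hw' : Nat.Coprime p w') {l m n : ℕ}
    (hl : l ≠ 0) (hm : m ≠ 0) (hn : n ≠ 0) (hi : padicValNat p l ≤ padicValNat p a.natAbs) :
    pmodel a (l * m * n) (p ^ ω * w') =
      ∑ j ∈ range (padicValNat p a.natAbs - padicValNat p l + 1),
        pdiv (p ^ j) m * pdiv (p ^ (padicValNat p a.natAbs - padicValNat p l - j)) n *
          pmodel (a / (p : ℤ) ^ padicValNat p a.natAbs)
            (l / p ^ padicValNat p l * (m / p ^ j) *
              (n / p ^ (padicValNat p a.natAbs - padicValNat p l - j)))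
            (p ^ (ω - padicValNat p a.natAbs) * w') := by
  haveI := Fact.mk hp
  set α := padicValNat p a.natAbs with hα
  set i := padicValNat p l with hi'
  obtain ⟨ha'0, hva', habs⟩ := div_padic_facts hp ha
  set a' := a / (p : ℤ) ^ α with ha'
  have hcopω : Nat.Coprime (p ^ ω) w' := Nat.Coprime.pow_left ω hw'
  have hcopωα : Nat.Coprime (p ^ (ω - α)) w' := Nat.Coprime.pow_left _ hw'
  have hcopα : Nat.Coprime (p ^ α) w' := Nat.Coprime.pow_left _ hw'
  have hk : l * m * n ≠ 0 := mul_ne_zero (mul_ne_zero hl hm) hn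
  -- the left side
  have hL : pmodel a (l * m * n) (p ^ ω * w') =
      (if padicValNat p (l * m * n) = α then ((Nat.totient (p ^ (ω - α)) : ℕ) : ℝ)⁻¹ else 0) *
        pmodel a (l * m * n) w' := by
    rw [pmodel_mul_of_coprime a _ hcopω, pmodel_prime_pow_of_lt hp ha hω hk]
  -- the value of a generic present term
  have hterm : ∀ j ∈ range (α - i + 1), p ^ j ∣ m → p ^ (α - i - j) ∣ n →
      pmodel a' (l / p ^ i * (m / p ^ j) * (n / p ^ (α - i - j))) (p ^ (ω - α) * w') =
        (if padicValNat p (l * m * n) = α then ((Nat.totient (p ^ (ω - α)) : ℕ) : ℝ)⁻¹ else 0) *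
          pmodel a (l * m * n) w' := by
    intro j hj hjm hjn
    have hjle : j ≤ α - i := by have := Finset.mem_range.1 hj; omega
    obtain ⟨hge, hk0, hvk, hprod⟩ := core_U hp hl hm hn hi'.symm hi hjle hjm hjn
    set k' := l / p ^ i * (m / p ^ j) * (n / p ^ (α - i - j))
    have hωα : padicValNat p a'.natAbs < ω - α := by rw [hva']; omega
    rw [pmodel_mul_of_coprime a' _ hcopωα, pmodel_prime_pow_of_lt hp ha'0 hωα hk0, hva',
      Nat.sub_zero]
    -- `P_{a'}(k'; w') = P_a(lmn; w')`
    have hw'eq : pmodel a' k' w' = pmodel a (l * m * n) w' := by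
      unfold pmodel
      rw [hprod, habs, Nat.Coprime.gcd_mul_left_cancel _ hcopα,
        Nat.Coprime.gcd_mul_left_cancel _ hcopα]
    rw [hw'eq]
    congr 1
    by_cases hlam : padicValNat p (l * m * n) = α
    · rw [if_pos hlam, if_pos (by rw [hvk, hlam, Nat.sub_self])]
    · rw [if_neg hlam, if_neg (by rw [hvk]; omega)]
  rw [hL]
  by_cases hlam : padicValNat p (l * m * n) = α
  · have hvmem : padicValNat p m ∈ range (α - i + 1) := by
      have hvlmn : padicValNat p (l * m * n) = padicValNat p l + padicValNat p m + padicValNat p n := by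
        rw [padicValNat.mul (mul_ne_zero hl hm) hn, padicValNat.mul hl hm]
      rw [Finset.mem_range]; omega
    rw [Finset.sum_eq_single_of_mem (padicValNat p m) hvmem]
    · have hpres := (present_iff_of_eq (j := padicValNat p m) hp hl hm hn hi'.symm hlam).2 rfl
      rw [pdiv_of_dvd hpres.1, pdiv_of_dvd hpres.2, one_mul, one_mul,
        hterm _ hvmem hpres.1 hpres.2]
    · intro j hj hne
      by_cases hjm : p ^ j ∣ m
      · by_cases hjn : p ^ (α - i - j) ∣ n
        · exact absurd ((present_iff_of_eq hp hl hm hn hi'.symm hlam).1 ⟨hjm, hjn⟩) hne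
        · rw [pdiv_of_not_dvd hjn, mul_zero, zero_mul]
      · rw [pdiv_of_not_dvd hjm, zero_mul, zero_mul]
  · rw [if_neg hlam, zero_mul]
    symm
    refine Finset.sum_eq_zero fun j hj => ?_
    by_cases hjm : p ^ j ∣ m
    · by_cases hjn : p ^ (α - i - j) ∣ n
      · rw [hterm j hj hjm hjn, if_neg hlam, zero_mul, mul_zero]
      · rw [pdiv_of_not_dvd hjn, mul_zero, zero_mul]
    · rw [pdiv_of_not_dvd hjm, zero_mul, zero_mul]

/-- In the case `ω > α` with `v_p(l) > α` the model weight vanishes too. [folklore] -/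
theorem pmodel_eq_zero_of_lt_padicValNat {p : ℕ} (hp : p.Prime) {a : ℤ} (ha : a ≠ 0) {ω : ℕ}
    (hω : padicValNat p a.natAbs < ω) {w' : ℕ} (hw' : Nat.Coprime p w') {l m n : ℕ} (hl : l ≠ 0)
    (hm : m ≠ 0) (hn : n ≠ 0) (hi : padicValNat p a.natAbs < padicValNat p l) :
    pmodel a (l * m * n) (p ^ ω * w') = 0 := by
  haveI := Fact.mk hp
  have hk : l * m * n ≠ 0 := mul_ne_zero (mul_ne_zero hl hm) hn
  rw [pmodel_mul_of_coprime a _ (Nat.Coprime.pow_left ω hw'), pmodel_prime_pow_of_lt hp ha hω hk,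
    if_neg, zero_mul]
  have hvlmn : padicValNat p (l * m * n) = padicValNat p l + padicValNat p m + padicValNat p n := by
    rw [padicValNat.mul (mul_ne_zero hl hm) hn, padicValNat.mul hl hm]
  omega

/-! ### The pointwise reduction at one prime, case `ω ≤ α` -/

/-- **Case `ω ≤ α` (`p^ω ∣ a`), congruence indicator**: for `p ∤ w'`,
`[p^ω w' ∣ lmn − a] = [p^{ω − min(ω, v_p l)} ∣ mn] · [w' ∣ lmn − a]`. [folklore] -/
theorem dind_split_G {p : ℕ} (hp : p.Prime) {a : ℤ} {ω : ℕ} (hpa : (p : ℤ) ^ ω ∣ a) {w' : ℕ}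
    (hw' : Nat.Coprime p w') {l m n : ℕ} (hl : l ≠ 0) (hm : m ≠ 0) (hn : n ≠ 0) :
    dind (p ^ ω * w') (l * m * n) a =
      pdiv (p ^ (ω - min ω (padicValNat p l))) (m * n) * dind w' (l * m * n) a := by
  rw [dind_mul_of_coprime (Nat.Coprime.pow_left ω hw'), dind_eq_pdiv_of_dvd (by exact_mod_cast hpa),
    pdiv_pow_mul_mul hp ω hl hm hn]

/-- **Case `ω ≤ α` (`p^ω ∣ a`), model weight**: for `p ∤ w'`,
`P_a(lmn; p^ω w') = [p^{ω − min(ω, v_p l)} ∣ mn] · P_a(lmn; w')`. [folklore] -/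
theorem pmodel_split_G {p : ℕ} (hp : p.Prime) {a : ℤ} {ω : ℕ} (hpa : p ^ ω ∣ a.natAbs) {w' : ℕ}
    (hw' : Nat.Coprime p w') {l m n : ℕ} (hl : l ≠ 0) (hm : m ≠ 0) (hn : n ≠ 0) :
    pmodel a (l * m * n) (p ^ ω * w') =
      pdiv (p ^ (ω - min ω (padicValNat p l))) (m * n) * pmodel a (l * m * n) w' := by
  rw [pmodel_mul_of_coprime a _ (Nat.Coprime.pow_left ω hw'), pmodel_prime_pow_of_dvd hp hpa,
    pdiv_pow_mul_mul hp ω hl hm hn]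


/-! ### Dividing a range of a variable by `D` -/

/-- `S / D`: the quotients `m / D` of the multiples of `D` in `S`. [folklore] -/
def sdiv (S : Finset ℕ) (D : ℕ) : Finset ℕ := (S.filter (fun m => D ∣ m)).image (fun m => m / D)

/-- `m' ∈ S/D ⇔ D m' ∈ S`. [folklore] -/
theorem mem_sdiv {S : Finset ℕ} {D : ℕ} (hD : 0 < D) {m' : ℕ} :
    m' ∈ sdiv S D ↔ D * m' ∈ S := by
  unfold sdiv
  rw [Finset.mem_image]
  constructor
  · rintro ⟨m, hm, rfl⟩
    rw [Finset.mem_filter] at hm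
    rw [Nat.mul_div_cancel' hm.2]
    exact hm.1
  · intro h
    exact ⟨D * m', Finset.mem_filter.2 ⟨h, dvd_mul_right D m'⟩, by rw [Nat.mul_div_cancel_left _ hD]⟩

/-- `S/D` consists of positive integers if `S` does. [folklore] -/
theorem sdiv_pos {S : Finset ℕ} (hS : ∀ m ∈ S, 0 < m) {D : ℕ} (hD : 0 < D) :
    ∀ m' ∈ sdiv S D, 0 < m' := by
  intro m' hm'
  rw [mem_sdiv hD] at hm'
  have := hS _ hm'
  rcases Nat.eq_zero_or_pos m' with h | h
  · rw [h, mul_zero] at this; exact absurd this (lt_irrefl 0)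
  · exact h

/-- `S/1 = S`. [folklore] -/
@[simp] theorem sdiv_one (S : Finset ℕ) : sdiv S 1 = S := by
  ext m; rw [mem_sdiv one_pos, one_mul]

/-- `(S/D₁)/D₂ = S/(D₁D₂)`. [folklore] -/
theorem sdiv_sdiv (S : Finset ℕ) {D₁ D₂ : ℕ} (h₁ : 0 < D₁) (h₂ : 0 < D₂) :
    sdiv (sdiv S D₁) D₂ = sdiv S (D₁ * D₂) := by
  ext m; rw [mem_sdiv h₂, mem_sdiv h₁, mem_sdiv (mul_pos h₁ h₂), mul_assoc]

/-- `[1, X]/D = [1, X/D]`. [folklore] -/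
theorem sdiv_Icc {D : ℕ} (hD : 0 < D) (X : ℕ) : sdiv (Icc 1 X) D = Icc 1 (X / D) := by
  ext m
  rw [mem_sdiv hD, Finset.mem_Icc, Finset.mem_Icc, Nat.le_div_iff_mul_le hD, mul_comm]
  constructor
  · rintro ⟨h1, h2⟩
    refine ⟨?_, h2⟩
    rcases Nat.eq_zero_or_pos m with h | h
    · rw [h, zero_mul] at h1; exact absurd h1 (by norm_num)
    · exact h
  · rintro ⟨h1, h2⟩
    exact ⟨le_trans hD (Nat.le_mul_of_pos_left D h1), h2⟩

/-- **Reindexing a sum over the multiples of `D`.** [folklore] -/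
theorem sum_pdiv_mul (S : Finset ℕ) (D : ℕ) (f : ℕ → ℝ) :
    ∑ m ∈ S, pdiv D m * f m = ∑ m' ∈ sdiv S D, f (D * m') := by
  have h1 : ∑ m ∈ S, pdiv D m * f m = ∑ m ∈ S.filter (fun m => D ∣ m), f m := by
    rw [Finset.sum_filter]
    refine Finset.sum_congr rfl fun m _ => ?_
    unfold pdiv; split_ifs <;> simp
  rw [h1]
  unfold sdiv
  rw [Finset.sum_image]
  · refine Finset.sum_congr rfl fun m hm => ?_
    rw [Finset.mem_filter] at hm
    rw [Nat.mul_div_cancel' hm.2]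
  · intro m₁ hm₁ m₂ hm₂ h
    rw [Finset.mem_coe, Finset.mem_filter] at hm₁ hm₂
    have := congrArg (fun x => D * x) h
    simp only at this
    rwa [Nat.mul_div_cancel' hm₁.2, Nat.mul_div_cancel' hm₂.2] at this

/-- `∑_m ∑_n ∑_j = ∑_j ∑_m ∑_n`. [folklore] -/
theorem sum_sum_sum_comm' {α β γ : Type*} (SM : Finset α) (SN : Finset β) (J : Finset γ)
    (f : γ → α → β → ℝ) :
    ∑ m ∈ SM, ∑ n ∈ SN, ∑ j ∈ J, f j m n = ∑ j ∈ J, ∑ m ∈ SM, ∑ n ∈ SN, f j m n := by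
  calc ∑ m ∈ SM, ∑ n ∈ SN, ∑ j ∈ J, f j m n = ∑ m ∈ SM, ∑ j ∈ J, ∑ n ∈ SN, f j m n :=
        Finset.sum_congr rfl fun m _ => Finset.sum_comm
    _ = ∑ j ∈ J, ∑ m ∈ SM, ∑ n ∈ SN, f j m n := Finset.sum_comm

/-- **The reindexing workhorse**: a double sum with the factor `[Dm ∣ m][Dn ∣ n]` and a weight
depending on `(m/Dm, n/Dn)` is `ρ(Dm)ρ(Dn)` times the sum over the divided ranges. [folklore] -/
theorem sum_sum_pdiv_pdiv (z : ℝ) {SM SN : Finset ℕ} (hSM : ∀ m ∈ SM, 0 < m) (hSN : ∀ n ∈ SN, 0 < n)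
    {Dm Dn : ℕ} (hDm : 0 < Dm) (hDn : 0 < Dn) (L₀ : ℕ) (lo hi : ℤ) (G : ℕ → ℕ → ℝ) :
    ∑ m ∈ SM, ∑ n ∈ SN, pdiv Dm m * pdiv Dn n * G (m / Dm) (n / Dn) * wind lo hi (L₀ * m * n) *
        (roughIndicator z m * roughIndicator z n) =
      roughIndicator z Dm * roughIndicator z Dn *
        ∑ m' ∈ sdiv SM Dm, ∑ n' ∈ sdiv SN Dn, G m' n' * wind lo hi (L₀ * Dm * Dn * m' * n') *
          (roughIndicator z m' * roughIndicator z n') := by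
  -- the `m`-sum
  have step1 : ∀ m ∈ SM, ∑ n ∈ SN, pdiv Dm m * pdiv Dn n * G (m / Dm) (n / Dn) *
      wind lo hi (L₀ * m * n) * (roughIndicator z m * roughIndicator z n) =
      pdiv Dm m * (roughIndicator z m * roughIndicator z Dn *
        ∑ n' ∈ sdiv SN Dn, G (m / Dm) n' * wind lo hi (L₀ * m * (Dn * n')) * roughIndicator z n') := by
    intro m _
    have : ∀ n ∈ SN, pdiv Dm m * pdiv Dn n * G (m / Dm) (n / Dn) * wind lo hi (L₀ * m * n) *
        (roughIndicator z m * roughIndicator z n) =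
        pdiv Dm m * (pdiv Dn n * (roughIndicator z m * (G (m / Dm) (n / Dn) *
          wind lo hi (L₀ * m * n) * roughIndicator z n))) := by
      intro n _; ring
    rw [Finset.sum_congr rfl this, ← Finset.mul_sum, sum_pdiv_mul SN Dn]
    congr 1
    rw [Finset.mul_sum]
    refine Finset.sum_congr rfl fun n' hn' => ?_
    have hn'0 : n' ≠ 0 := (sdiv_pos hSN hDn n' hn').ne'
    rw [Nat.mul_div_cancel_left n' hDn, roughIndicator_mul hDn.ne' hn'0]
    ring
  rw [Finset.sum_congr rfl step1, sum_pdiv_mul SM Dm, Finset.mul_sum]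
  refine Finset.sum_congr rfl fun m' hm' => ?_
  have hm'0 : m' ≠ 0 := (sdiv_pos hSM hDm m' hm').ne'
  rw [Nat.mul_div_cancel_left m' hDm, roughIndicator_mul hDm.ne' hm'0, Finset.mul_sum, Finset.mul_sum]
  refine Finset.sum_congr rfl fun n' _ => ?_
  have : L₀ * (Dm * m') * (Dn * n') = L₀ * Dm * Dn * m' * n' := by ring
  rw [this]
  ring

/-! ### The generalized switched congruence counts and their expected values -/

/-- **The generalized switched congruence count**
`∑_{m ∈ SM, n ∈ SN} ρ(m)ρ(n) [w ∣ lc·m·n − a] [lo < L₀·m·n ≤ hi]`: a congruence count for the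
product of the two inner variables, with a coefficient `lc` in the congruence, a (possibly
different) coefficient `L₀` in the window, and the rough weights.  In the application
`w = d·r·s`, `lc = L₀ = l` initially, and the window is `Q'rs < lmn − a ≤ 2Q'rs`.
[cite: BombieriFriedlanderIwaniecActa1986, §13 p. 241–242] -/
def gcount (a : ℤ) (z : ℝ) (SM SN : Finset ℕ) (lc L₀ w : ℕ) (lo hi : ℤ) : ℝ :=
  ∑ m ∈ SM, ∑ n ∈ SN,
    dind w (lc * m * n) a * wind lo hi (L₀ * m * n) * (roughIndicator z m * roughIndicator z n)

/-- **The expected value attached to `gcount`**: the same sum with `[w ∣ lc m n − a]` replaced by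
the model weight `P_a(lc m n; w)`. [folklore] -/
def gmodel (a : ℤ) (z : ℝ) (SM SN : Finset ℕ) (lc L₀ w : ℕ) (lo hi : ℤ) : ℝ :=
  ∑ m ∈ SM, ∑ n ∈ SN,
    pmodel a (lc * m * n) w * wind lo hi (L₀ * m * n) * (roughIndicator z m * roughIndicator z n)

/-- `gcount ≥ 0`. [folklore] -/
theorem gcount_nonneg (a : ℤ) (z : ℝ) (SM SN : Finset ℕ) (lc L₀ w : ℕ) (lo hi : ℤ) :
    0 ≤ gcount a z SM SN lc L₀ w lo hi :=
  Finset.sum_nonneg fun _ _ => Finset.sum_nonneg fun _ _ =>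
    mul_nonneg (mul_nonneg (dind_nonneg _ _ _) (wind_nonneg _ _ _))
      (mul_nonneg (roughIndicator_nonneg _ _) (roughIndicator_nonneg _ _))

/-- `gmodel ≥ 0`. [folklore] -/
theorem gmodel_nonneg (a : ℤ) (z : ℝ) (SM SN : Finset ℕ) (lc L₀ w : ℕ) (lo hi : ℤ) :
    0 ≤ gmodel a z SM SN lc L₀ w lo hi :=
  Finset.sum_nonneg fun _ _ => Finset.sum_nonneg fun _ _ =>
    mul_nonneg (mul_nonneg (pmodel_nonneg _ _ _) (wind_nonneg _ _ _))
      (mul_nonneg (roughIndicator_nonneg _ _) (roughIndicator_nonneg _ _))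

/-! ### One prime, summed: case `ω ≤ α` -/

/-- **`G`-step for the count**: for `p^ω ∣ a`, `p ∤ w'`, `t = ω − min(ω, v_p lc)`,
`gcount(a; SM, SN; lc, L₀; p^ω w') = ∑_{j ≤ t} ρ(p^{t−j})ρ(p^j) gcount(a; SM/p^{t−j}, SN/p^j; lc p^t, L₀ p^t; w')
 − ∑_{j < t} ρ(p^{t−j})ρ(p^{j+1}) gcount(a; SM/p^{t−j}, SN/p^{j+1}; lc p^{t+1}, L₀ p^{t+1}; w')`.
[cite: BombieriFriedlanderIwaniecActa1986, §13 p. 241–242] -/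
theorem gcount_step_G {p : ℕ} (hp : p.Prime) {a : ℤ} {ω : ℕ} (hpa : (p : ℤ) ^ ω ∣ a) {w' : ℕ}
    (hw' : Nat.Coprime p w') (z : ℝ) {SM SN : Finset ℕ} (hSM : ∀ m ∈ SM, 0 < m)
    (hSN : ∀ n ∈ SN, 0 < n) {lc : ℕ} (hlc : lc ≠ 0) (L₀ : ℕ) (lo hi : ℤ) :
    gcount a z SM SN lc L₀ (p ^ ω * w') lo hi =
      ∑ j ∈ range (ω - min ω (padicValNat p lc) + 1),
        roughIndicator z (p ^ (ω - min ω (padicValNat p lc) - j)) * roughIndicator z (p ^ j) *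
          gcount a z (sdiv SM (p ^ (ω - min ω (padicValNat p lc) - j))) (sdiv SN (p ^ j))
            (lc * p ^ (ω - min ω (padicValNat p lc))) (L₀ * p ^ (ω - min ω (padicValNat p lc)))
            w' lo hi -
      ∑ j ∈ range (ω - min ω (padicValNat p lc)),
        roughIndicator z (p ^ (ω - min ω (padicValNat p lc) - j)) * roughIndicator z (p ^ (j + 1)) *
          gcount a z (sdiv SM (p ^ (ω - min ω (padicValNat p lc) - j))) (sdiv SN (p ^ (j + 1)))
            (lc * p ^ (ω - min ω (padicValNat p lc) + 1))
            (L₀ * p ^ (ω - min ω (padicValNat p lc) + 1)) w' lo hi := by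
  set t := ω - min ω (padicValNat p lc) with ht
  have hp0 : 0 < p := hp.pos
  -- pointwise expansion of the summand
  have hpt : ∀ m ∈ SM, ∀ n ∈ SN,
      dind (p ^ ω * w') (lc * m * n) a * wind lo hi (L₀ * m * n) *
        (roughIndicator z m * roughIndicator z n) =
      ∑ j ∈ range (t + 1), pdiv (p ^ (t - j)) m * pdiv (p ^ j) n *
          dind w' (lc * p ^ t * (m / p ^ (t - j)) * (n / p ^ j)) a * wind lo hi (L₀ * m * n) *
          (roughIndicator z m * roughIndicator z n) -
      ∑ j ∈ range t, pdiv (p ^ (t - j)) m * pdiv (p ^ (j + 1)) n *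
          dind w' (lc * p ^ (t + 1) * (m / p ^ (t - j)) * (n / p ^ (j + 1))) a *
          wind lo hi (L₀ * m * n) * (roughIndicator z m * roughIndicator z n) := by
    intro m hm n hn
    have hm0 := (hSM m hm).ne'
    have hn0 := (hSN n hn).ne'
    rw [dind_split_G hp hpa hw' hlc hm0 hn0, ← ht, pdiv_pow_mul_expand hp t hm0 hn0, sub_mul, sub_mul,
      sub_mul, Finset.sum_mul, Finset.sum_mul, Finset.sum_mul, Finset.sum_mul, Finset.sum_mul,
      Finset.sum_mul]
    congr 1
    · refine Finset.sum_congr rfl fun j hj => ?_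
      have hjt : j ≤ t := Nat.lt_succ_iff.1 (Finset.mem_range.1 hj)
      by_cases h1 : p ^ (t - j) ∣ m
      · by_cases h2 : p ^ j ∣ n
        · have e : lc * p ^ t * (m / p ^ (t - j)) * (n / p ^ j) = lc * m * n := by
            have em := Nat.div_mul_cancel h1
            have en := Nat.div_mul_cancel h2
            have hpow : p ^ t = p ^ (t - j) * p ^ j := by rw [← pow_add]; congr 1; omega
            calc lc * p ^ t * (m / p ^ (t - j)) * (n / p ^ j)
                = lc * ((m / p ^ (t - j)) * p ^ (t - j)) * ((n / p ^ j) * p ^ j) := by rw [hpow]; ring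
              _ = lc * m * n := by rw [em, en]
          rw [e]; ring
        · rw [pdiv_of_not_dvd h2]; ring
      · rw [pdiv_of_not_dvd h1]; ring
    · refine Finset.sum_congr rfl fun j hj => ?_
      have hjt : j < t := Finset.mem_range.1 hj
      by_cases h1 : p ^ (t - j) ∣ m
      · by_cases h2 : p ^ (j + 1) ∣ n
        · have e : lc * p ^ (t + 1) * (m / p ^ (t - j)) * (n / p ^ (j + 1)) = lc * m * n := by
            have em := Nat.div_mul_cancel h1
            have en := Nat.div_mul_cancel h2
            have hpow : p ^ (t + 1) = p ^ (t - j) * p ^ (j + 1) := by rw [← pow_add]; congr 1; omega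
            calc lc * p ^ (t + 1) * (m / p ^ (t - j)) * (n / p ^ (j + 1))
                = lc * ((m / p ^ (t - j)) * p ^ (t - j)) * ((n / p ^ (j + 1)) * p ^ (j + 1)) := by
                  rw [hpow]; ring
              _ = lc * m * n := by rw [em, en]
          rw [e]; ring
        · rw [pdiv_of_not_dvd h2]; ring
      · rw [pdiv_of_not_dvd h1]; ring
  unfold gcount
  rw [Finset.sum_congr rfl fun m hm => Finset.sum_congr rfl fun n hn => hpt m hm n hn]
  simp only [Finset.sum_sub_distrib]
  rw [sum_sum_sum_comm' SM SN (range (t + 1)), sum_sum_sum_comm' SM SN (range t)]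
  congr 1
  · refine Finset.sum_congr rfl fun j hj => ?_
    rw [sum_sum_pdiv_pdiv z hSM hSN (pow_pos hp0 _) (pow_pos hp0 _) L₀ lo hi
      (fun m' n' => dind w' (lc * p ^ t * m' * n') a)]
    congr 1
    refine Finset.sum_congr rfl fun m' _ => Finset.sum_congr rfl fun n' _ => ?_
    have hpow : p ^ t = p ^ (t - j) * p ^ j := by
      rw [← pow_add]; congr 1
      have := Finset.mem_range.1 hj; omega
    have : L₀ * p ^ (t - j) * p ^ j * m' * n' = L₀ * p ^ t * m' * n' := by rw [hpow]; ring
    rw [this]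
  · refine Finset.sum_congr rfl fun j hj => ?_
    rw [sum_sum_pdiv_pdiv z hSM hSN (pow_pos hp0 _) (pow_pos hp0 _) L₀ lo hi
      (fun m' n' => dind w' (lc * p ^ (t + 1) * m' * n') a)]
    congr 1
    refine Finset.sum_congr rfl fun m' _ => Finset.sum_congr rfl fun n' _ => ?_
    have hpow : p ^ (t + 1) = p ^ (t - j) * p ^ (j + 1) := by
      rw [← pow_add]; congr 1
      have := Finset.mem_range.1 hj; omega
    have : L₀ * p ^ (t - j) * p ^ (j + 1) * m' * n' = L₀ * p ^ (t + 1) * m' * n' := by rw [hpow]; ring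
    rw [this]


/-- **Generic one-prime step for the sums**: a pointwise expansion of the weight `F` into terms
`[Dm_j ∣ m][Dn_j ∣ n] G_j(m/Dm_j, n/Dn_j)` lifts to the double sums with the window and the rough
weights. [folklore] -/
theorem gsum_step (z : ℝ) {SM SN : Finset ℕ} (hSM : ∀ m ∈ SM, 0 < m) (hSN : ∀ n ∈ SN, 0 < n)
    (L₀ : ℕ) (lo hi : ℤ) (F : ℕ → ℕ → ℝ) (J : Finset ℕ) (Dm Dn : ℕ → ℕ)
    (hDm : ∀ j ∈ J, 0 < Dm j) (hDn : ∀ j ∈ J, 0 < Dn j) (G : ℕ → ℕ → ℕ → ℝ)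
    (hF : ∀ m ∈ SM, ∀ n ∈ SN,
      F m n = ∑ j ∈ J, pdiv (Dm j) m * pdiv (Dn j) n * G j (m / Dm j) (n / Dn j)) :
    ∑ m ∈ SM, ∑ n ∈ SN, F m n * wind lo hi (L₀ * m * n) * (roughIndicator z m * roughIndicator z n) =
      ∑ j ∈ J, roughIndicator z (Dm j) * roughIndicator z (Dn j) *
        ∑ m' ∈ sdiv SM (Dm j), ∑ n' ∈ sdiv SN (Dn j),
          G j m' n' * wind lo hi (L₀ * Dm j * Dn j * m' * n') *
            (roughIndicator z m' * roughIndicator z n') := by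
  have hpt : ∀ m ∈ SM, ∀ n ∈ SN,
      F m n * wind lo hi (L₀ * m * n) * (roughIndicator z m * roughIndicator z n) =
      ∑ j ∈ J, pdiv (Dm j) m * pdiv (Dn j) n * G j (m / Dm j) (n / Dn j) *
        wind lo hi (L₀ * m * n) * (roughIndicator z m * roughIndicator z n) := by
    intro m hm n hn
    rw [hF m hm n hn, Finset.sum_mul, Finset.sum_mul]
  rw [Finset.sum_congr rfl fun m hm => Finset.sum_congr rfl fun n hn => hpt m hm n hn,
    sum_sum_sum_comm' SM SN J]
  refine Finset.sum_congr rfl fun j hj => ?_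
  exact sum_sum_pdiv_pdiv z hSM hSN (hDm j hj) (hDn j hj) L₀ lo hi (G j)

/-- **`U`-step for the count**: for `ω > α = v_p(a)`, `i = v_p(lc) ≤ α` (any `w'`),
`gcount(a; SM, SN; lc, L₀; p^ω w') = ∑_{j ≤ α−i} ρ(p^j)ρ(p^{α−i−j})
  gcount(a/p^α; SM/p^j, SN/p^{α−i−j}; lc/p^i, L₀ p^j p^{α−i−j}; p^{ω−α} w')`.
[cite: BombieriFriedlanderIwaniecActa1986, §13 p. 241–242] -/
theorem gcount_step_U {p : ℕ} (hp : p.Prime) {a : ℤ} (ha : a ≠ 0) {ω : ℕ}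
    (hω : padicValNat p a.natAbs < ω) (w' : ℕ) (z : ℝ) {SM SN : Finset ℕ}
    (hSM : ∀ m ∈ SM, 0 < m) (hSN : ∀ n ∈ SN, 0 < n) {lc : ℕ} (hlc : lc ≠ 0)
    (hi : padicValNat p lc ≤ padicValNat p a.natAbs) (L₀ : ℕ) (lo hi' : ℤ) :
    gcount a z SM SN lc L₀ (p ^ ω * w') lo hi' =
      ∑ j ∈ range (padicValNat p a.natAbs - padicValNat p lc + 1),
        roughIndicator z (p ^ j) * roughIndicator z (p ^ (padicValNat p a.natAbs - padicValNat p lc - j)) *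
          gcount (a / (p : ℤ) ^ padicValNat p a.natAbs) z (sdiv SM (p ^ j))
            (sdiv SN (p ^ (padicValNat p a.natAbs - padicValNat p lc - j))) (lc / p ^ padicValNat p lc)
            (L₀ * p ^ j * p ^ (padicValNat p a.natAbs - padicValNat p lc - j))
            (p ^ (ω - padicValNat p a.natAbs) * w') lo hi' := by
  unfold gcount
  rw [gsum_step z hSM hSN L₀ lo hi' (fun m n => dind (p ^ ω * w') (lc * m * n) a)
    (range (padicValNat p a.natAbs - padicValNat p lc + 1)) (fun j => p ^ j)
    (fun j => p ^ (padicValNat p a.natAbs - padicValNat p lc - j)) (fun j _ => pow_pos hp.pos _)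
    (fun j _ => pow_pos hp.pos _)
    (fun _ m' n' => dind (p ^ (ω - padicValNat p a.natAbs) * w') (lc / p ^ padicValNat p lc * m' * n')
      (a / (p : ℤ) ^ padicValNat p a.natAbs))
    (fun m hm n hn => dind_expand_U hp ha hω w' hlc (hSM m hm).ne' (hSN n hn).ne' hi)]

/-- **`U`-step for the model**: the same decomposition for `gmodel` (`p ∤ w'`). [folklore] -/
theorem gmodel_step_U {p : ℕ} (hp : p.Prime) {a : ℤ} (ha : a ≠ 0) {ω : ℕ}
    (hω : padicValNat p a.natAbs < ω) {w' : ℕ} (hw' : Nat.Coprime p w') (z : ℝ) {SM SN : Finset ℕ}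
    (hSM : ∀ m ∈ SM, 0 < m) (hSN : ∀ n ∈ SN, 0 < n) {lc : ℕ} (hlc : lc ≠ 0)
    (hi : padicValNat p lc ≤ padicValNat p a.natAbs) (L₀ : ℕ) (lo hi' : ℤ) :
    gmodel a z SM SN lc L₀ (p ^ ω * w') lo hi' =
      ∑ j ∈ range (padicValNat p a.natAbs - padicValNat p lc + 1),
        roughIndicator z (p ^ j) * roughIndicator z (p ^ (padicValNat p a.natAbs - padicValNat p lc - j)) *
          gmodel (a / (p : ℤ) ^ padicValNat p a.natAbs) z (sdiv SM (p ^ j))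
            (sdiv SN (p ^ (padicValNat p a.natAbs - padicValNat p lc - j))) (lc / p ^ padicValNat p lc)
            (L₀ * p ^ j * p ^ (padicValNat p a.natAbs - padicValNat p lc - j))
            (p ^ (ω - padicValNat p a.natAbs) * w') lo hi' := by
  unfold gmodel
  rw [gsum_step z hSM hSN L₀ lo hi' (fun m n => pmodel a (lc * m * n) (p ^ ω * w'))
    (range (padicValNat p a.natAbs - padicValNat p lc + 1)) (fun j => p ^ j)
    (fun j => p ^ (padicValNat p a.natAbs - padicValNat p lc - j)) (fun j _ => pow_pos hp.pos _)
    (fun j _ => pow_pos hp.pos _)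
    (fun _ m' n' => pmodel (a / (p : ℤ) ^ padicValNat p a.natAbs) (lc / p ^ padicValNat p lc * m' * n')
      (p ^ (ω - padicValNat p a.natAbs) * w'))
    (fun m hm n hn => pmodel_expand_U hp ha hω hw' hlc (hSM m hm).ne' (hSN n hn).ne' hi)]

/-- **`G`-step for the model**: for `p^ω ∣ a`, `p ∤ w'`, `t = ω − min(ω, v_p lc)`, the analogue of
`gcount_step_G`. [folklore] -/
theorem gmodel_step_G {p : ℕ} (hp : p.Prime) {a : ℤ} {ω : ℕ} (hpa : p ^ ω ∣ a.natAbs) {w' : ℕ}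
    (hw' : Nat.Coprime p w') (z : ℝ) {SM SN : Finset ℕ} (hSM : ∀ m ∈ SM, 0 < m)
    (hSN : ∀ n ∈ SN, 0 < n) {lc : ℕ} (hlc : lc ≠ 0) (L₀ : ℕ) (lo hi : ℤ) :
    gmodel a z SM SN lc L₀ (p ^ ω * w') lo hi =
      ∑ j ∈ range (ω - min ω (padicValNat p lc) + 1),
        roughIndicator z (p ^ (ω - min ω (padicValNat p lc) - j)) * roughIndicator z (p ^ j) *
          gmodel a z (sdiv SM (p ^ (ω - min ω (padicValNat p lc) - j))) (sdiv SN (p ^ j))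
            (lc * p ^ (ω - min ω (padicValNat p lc))) (L₀ * p ^ (ω - min ω (padicValNat p lc)))
            w' lo hi -
      ∑ j ∈ range (ω - min ω (padicValNat p lc)),
        roughIndicator z (p ^ (ω - min ω (padicValNat p lc) - j)) * roughIndicator z (p ^ (j + 1)) *
          gmodel a z (sdiv SM (p ^ (ω - min ω (padicValNat p lc) - j))) (sdiv SN (p ^ (j + 1)))
            (lc * p ^ (ω - min ω (padicValNat p lc) + 1))
            (L₀ * p ^ (ω - min ω (padicValNat p lc) + 1)) w' lo hi := by
  set t := ω - min ω (padicValNat p lc) with ht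
  have hp0 : 0 < p := hp.pos
  -- `F = F₁ − F₂` pointwise
  set F₁ : ℕ → ℕ → ℝ := fun m n =>
    ∑ j ∈ range (t + 1), pdiv (p ^ (t - j)) m * pdiv (p ^ j) n *
      pmodel a (lc * p ^ t * (m / p ^ (t - j)) * (n / p ^ j)) w' with hF₁
  set F₂ : ℕ → ℕ → ℝ := fun m n =>
    ∑ j ∈ range t, pdiv (p ^ (t - j)) m * pdiv (p ^ (j + 1)) n *
      pmodel a (lc * p ^ (t + 1) * (m / p ^ (t - j)) * (n / p ^ (j + 1))) w' with hF₂
  have hpt : ∀ m ∈ SM, ∀ n ∈ SN, pmodel a (lc * m * n) (p ^ ω * w') = F₁ m n - F₂ m n := by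
    intro m hm n hn
    have hm0 := (hSM m hm).ne'
    have hn0 := (hSN n hn).ne'
    rw [pmodel_split_G hp hpa hw' hlc hm0 hn0, ← ht, pdiv_pow_mul_expand hp t hm0 hn0, sub_mul, hF₁, hF₂]
    simp only [Finset.sum_mul]
    congr 1
    · refine Finset.sum_congr rfl fun j hj => ?_
      by_cases h1 : p ^ (t - j) ∣ m
      · by_cases h2 : p ^ j ∣ n
        · have e : lc * p ^ t * (m / p ^ (t - j)) * (n / p ^ j) = lc * m * n := by
            have em := Nat.div_mul_cancel h1
            have en := Nat.div_mul_cancel h2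
            have hpow : p ^ t = p ^ (t - j) * p ^ j := by
              rw [← pow_add]; congr 1; have := Finset.mem_range.1 hj; omega
            calc lc * p ^ t * (m / p ^ (t - j)) * (n / p ^ j)
                = lc * ((m / p ^ (t - j)) * p ^ (t - j)) * ((n / p ^ j) * p ^ j) := by rw [hpow]; ring
              _ = lc * m * n := by rw [em, en]
          rw [e]; ring
        · rw [pdiv_of_not_dvd h2]; ring
      · rw [pdiv_of_not_dvd h1]; ring
    · refine Finset.sum_congr rfl fun j hj => ?_
      by_cases h1 : p ^ (t - j) ∣ m
      · by_cases h2 : p ^ (j + 1) ∣ n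
        · have e : lc * p ^ (t + 1) * (m / p ^ (t - j)) * (n / p ^ (j + 1)) = lc * m * n := by
            have em := Nat.div_mul_cancel h1
            have en := Nat.div_mul_cancel h2
            have hpow : p ^ (t + 1) = p ^ (t - j) * p ^ (j + 1) := by
              rw [← pow_add]; congr 1; have := Finset.mem_range.1 hj; omega
            calc lc * p ^ (t + 1) * (m / p ^ (t - j)) * (n / p ^ (j + 1))
                = lc * ((m / p ^ (t - j)) * p ^ (t - j)) * ((n / p ^ (j + 1)) * p ^ (j + 1)) := by
                  rw [hpow]; ring
              _ = lc * m * n := by rw [em, en]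
          rw [e]; ring
        · rw [pdiv_of_not_dvd h2]; ring
      · rw [pdiv_of_not_dvd h1]; ring
  have hsplit : gmodel a z SM SN lc L₀ (p ^ ω * w') lo hi =
      ∑ m ∈ SM, ∑ n ∈ SN, F₁ m n * wind lo hi (L₀ * m * n) * (roughIndicator z m * roughIndicator z n) -
      ∑ m ∈ SM, ∑ n ∈ SN, F₂ m n * wind lo hi (L₀ * m * n) * (roughIndicator z m * roughIndicator z n) := by
    unfold gmodel
    rw [← Finset.sum_sub_distrib]
    refine Finset.sum_congr rfl fun m hm => ?_
    rw [← Finset.sum_sub_distrib]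
    refine Finset.sum_congr rfl fun n hn => ?_
    rw [hpt m hm n hn]; ring
  rw [hsplit,
    gsum_step z hSM hSN L₀ lo hi F₁ (range (t + 1)) (fun j => p ^ (t - j)) (fun j => p ^ j)
      (fun j _ => pow_pos hp0 _) (fun j _ => pow_pos hp0 _)
      (fun _ m' n' => pmodel a (lc * p ^ t * m' * n') w') (fun m _ n _ => by rw [hF₁]),
    gsum_step z hSM hSN L₀ lo hi F₂ (range t) (fun j => p ^ (t - j)) (fun j => p ^ (j + 1))
      (fun j _ => pow_pos hp0 _) (fun j _ => pow_pos hp0 _)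
      (fun _ m' n' => pmodel a (lc * p ^ (t + 1) * m' * n') w') (fun m _ n _ => by rw [hF₂])]
  unfold gmodel
  congr 1
  · refine Finset.sum_congr rfl fun j hj => ?_
    congr 1
    refine Finset.sum_congr rfl fun m' _ => Finset.sum_congr rfl fun n' _ => ?_
    have hpow : p ^ t = p ^ (t - j) * p ^ j := by
      rw [← pow_add]; congr 1; have := Finset.mem_range.1 hj; omega
    have : L₀ * p ^ (t - j) * p ^ j * m' * n' = L₀ * p ^ t * m' * n' := by rw [hpow]; ring
    rw [this]
  · refine Finset.sum_congr rfl fun j hj => ?_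
    congr 1
    refine Finset.sum_congr rfl fun m' _ => Finset.sum_congr rfl fun n' _ => ?_
    have hpow : p ^ (t + 1) = p ^ (t - j) * p ^ (j + 1) := by
      rw [← pow_add]; congr 1; have := Finset.mem_range.1 hj; omega
    have : L₀ * p ^ (t - j) * p ^ (j + 1) * m' * n' = L₀ * p ^ (t + 1) * m' * n' := by rw [hpow]; ring
    rw [this]

/-! ### Degenerate configurations -/

/-- If `v_p(lc) > α = v_p(a)` and `p^ω ∣ w` with `ω > α`, the count vanishes. [folklore] -/
theorem gcount_eq_zero_of_lt {p : ℕ} (hp : p.Prime) {a : ℤ} (ha : a ≠ 0) {ω : ℕ}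
    (hω : padicValNat p a.natAbs < ω) (w' : ℕ) (z : ℝ) {SM SN : Finset ℕ}
    (hSM : ∀ m ∈ SM, 0 < m) (hSN : ∀ n ∈ SN, 0 < n) {lc : ℕ} (hlc : lc ≠ 0)
    (hi : padicValNat p a.natAbs < padicValNat p lc) (L₀ : ℕ) (lo hi' : ℤ) :
    gcount a z SM SN lc L₀ (p ^ ω * w') lo hi' = 0 := by
  unfold gcount
  refine Finset.sum_eq_zero fun m hm => Finset.sum_eq_zero fun n hn => ?_
  rw [dind_eq_zero_of_lt_padicValNat hp ha hω w' hlc (hSM m hm).ne' (hSN n hn).ne' hi, zero_mul, zero_mul]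

/-- If `v_p(lc) > α = v_p(a)` and `p^ω ∣ w` with `ω > α`, `p ∤ w'`, the model vanishes. [folklore] -/
theorem gmodel_eq_zero_of_lt {p : ℕ} (hp : p.Prime) {a : ℤ} (ha : a ≠ 0) {ω : ℕ}
    (hω : padicValNat p a.natAbs < ω) {w' : ℕ} (hw' : Nat.Coprime p w') (z : ℝ) {SM SN : Finset ℕ}
    (hSM : ∀ m ∈ SM, 0 < m) (hSN : ∀ n ∈ SN, 0 < n) {lc : ℕ} (hlc : lc ≠ 0)
    (hi : padicValNat p a.natAbs < padicValNat p lc) (L₀ : ℕ) (lo hi' : ℤ) :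
    gmodel a z SM SN lc L₀ (p ^ ω * w') lo hi' = 0 := by
  unfold gmodel
  refine Finset.sum_eq_zero fun m hm => Finset.sum_eq_zero fun n hn => ?_
  rw [pmodel_eq_zero_of_lt_padicValNat hp ha hω hw' hlc (hSM m hm).ne' (hSN n hn).ne' hi, zero_mul,
    zero_mul]


/-! ### `U`-steps in the shape used by the iteration (`ω = α + 1`, arbitrary cofactor) -/

/-- `gcount_step_U` at `ω = α + 1`: the new modulus is `p · w'`. [folklore] -/
theorem gcount_step_U' {p : ℕ} (hp : p.Prime) {a : ℤ} (ha : a ≠ 0) (w' : ℕ) (z : ℝ)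
    {SM SN : Finset ℕ} (hSM : ∀ m ∈ SM, 0 < m) (hSN : ∀ n ∈ SN, 0 < n) {lc : ℕ} (hlc : lc ≠ 0)
    (hi : padicValNat p lc ≤ padicValNat p a.natAbs) (L₀ : ℕ) (lo hi' : ℤ) :
    gcount a z SM SN lc L₀ (p ^ (padicValNat p a.natAbs + 1) * w') lo hi' =
      ∑ j ∈ range (padicValNat p a.natAbs - padicValNat p lc + 1),
        roughIndicator z (p ^ j) * roughIndicator z (p ^ (padicValNat p a.natAbs - padicValNat p lc - j)) *
          gcount (a / (p : ℤ) ^ padicValNat p a.natAbs) z (sdiv SM (p ^ j))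
            (sdiv SN (p ^ (padicValNat p a.natAbs - padicValNat p lc - j))) (lc / p ^ padicValNat p lc)
            (L₀ * p ^ j * p ^ (padicValNat p a.natAbs - padicValNat p lc - j))
            (p * w') lo hi' := by
  rw [gcount_step_U hp ha (Nat.lt_succ_self _) w' z hSM hSN hlc hi L₀ lo hi',
    show (padicValNat p a.natAbs).succ - padicValNat p a.natAbs = 1 by omega, pow_one]

/-- `gmodel_step_U` at `ω = α + 1` for an ARBITRARY cofactor `w' ≠ 0` (factor out its `p`-part):
the new modulus is `p · w'`. [folklore] -/
theorem gmodel_step_U' {p : ℕ} (hp : p.Prime) {a : ℤ} (ha : a ≠ 0) {w' : ℕ} (hw'0 : w' ≠ 0) (z : ℝ)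
    {SM SN : Finset ℕ} (hSM : ∀ m ∈ SM, 0 < m) (hSN : ∀ n ∈ SN, 0 < n) {lc : ℕ} (hlc : lc ≠ 0)
    (hi : padicValNat p lc ≤ padicValNat p a.natAbs) (L₀ : ℕ) (lo hi' : ℤ) :
    gmodel a z SM SN lc L₀ (p ^ (padicValNat p a.natAbs + 1) * w') lo hi' =
      ∑ j ∈ range (padicValNat p a.natAbs - padicValNat p lc + 1),
        roughIndicator z (p ^ j) * roughIndicator z (p ^ (padicValNat p a.natAbs - padicValNat p lc - j)) *
          gmodel (a / (p : ℤ) ^ padicValNat p a.natAbs) z (sdiv SM (p ^ j))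
            (sdiv SN (p ^ (padicValNat p a.natAbs - padicValNat p lc - j))) (lc / p ^ padicValNat p lc)
            (L₀ * p ^ j * p ^ (padicValNat p a.natAbs - padicValNat p lc - j))
            (p * w') lo hi' := by
  obtain ⟨v, w'', hw'', hdec⟩ := Nat.exists_eq_pow_mul_and_not_dvd hw'0 p hp.ne_one
  have hcop : Nat.Coprime p w'' := (Nat.Prime.coprime_iff_not_dvd hp).2 hw''
  set α := padicValNat p a.natAbs
  have e1 : p ^ (α + 1) * w' = p ^ (α + 1 + v) * w'' := by rw [hdec, pow_add]; ring
  have e2 : p * w' = p ^ (α + 1 + v - α) * w'' := by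
    rw [hdec, show α + 1 + v - α = 1 + v by omega, pow_add, pow_one]; ring
  rw [e1, e2]
  exact gmodel_step_U hp ha (by omega) hcop z hSM hSN hlc hi L₀ lo hi'

/-! ### Valuations at other primes -/

/-- `v_q(p^i x) = v_q(x)` for primes `q ≠ p`. [folklore] -/
theorem padicValNat_pow_mul_of_ne {p q : ℕ} (hp : p.Prime) (hq : q.Prime) (hne : q ≠ p) (i : ℕ)
    {x : ℕ} (hx : x ≠ 0) : padicValNat q (p ^ i * x) = padicValNat q x := by
  haveI := Fact.mk hp; haveI := Fact.mk hq
  rw [padicValNat.mul (pow_ne_zero _ hp.ne_zero) hx, padicValNat_prime_prime_pow i hne, zero_add]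

/-- `v_q(x / p^i) = v_q(x)` for primes `q ≠ p`, `p^i ∣ x`. [folklore] -/
theorem padicValNat_div_pow_of_ne {p q : ℕ} (hp : p.Prime) (hq : q.Prime) (hne : q ≠ p) {i x : ℕ}
    (hx : x ≠ 0) (h : p ^ i ∣ x) : padicValNat q (x / p ^ i) = padicValNat q x := by
  obtain ⟨hx', -⟩ := padicValNat_div_pow_eq hp hx h
  conv_rhs => rw [← Nat.mul_div_cancel' h]
  rw [padicValNat_pow_mul_of_ne hp hq hne i hx']

/-- `v_q(a / p^{v_p a}) = v_q(a)` for primes `q ≠ p`. [folklore] -/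
theorem padicValNat_natAbs_div_of_ne {p q : ℕ} (hp : p.Prime) (hq : q.Prime) (hne : q ≠ p) {a : ℤ}
    (ha : a ≠ 0) :
    padicValNat q (a / (p : ℤ) ^ padicValNat p a.natAbs).natAbs = padicValNat q a.natAbs := by
  obtain ⟨ha'0, -, habs⟩ := div_padic_facts hp ha
  conv_rhs => rw [habs]
  rw [padicValNat_pow_mul_of_ne hp hq hne _ (Int.natAbs_ne_zero.2 ha'0)]

/-! ### The constants of the full reduction -/

/-- The primes of `ps` at which `p^{v_p(a)+1} ∥ e` (the "`U`-primes" of the reduction). [folklore] -/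
def Uset (ps : List ℕ) (a : ℤ) (e : ℕ) : Finset ℕ :=
  ps.toFinset.filter (fun p => padicValNat p e = padicValNat p a.natAbs + 1)

/-- `E = ∏_{p ∈ U} p^{v_p(a)}`: the part of `a` divided out by the reduction. [folklore] -/
def Ered (ps : List ℕ) (a : ℤ) (e : ℕ) : ℕ := ∏ p ∈ Uset ps a e, p ^ padicValNat p a.natAbs

/-- `P = ∏_{p ∈ U} p`: the extra factor of the reduced modulus. [folklore] -/
def Pred (ps : List ℕ) (a : ℤ) (e : ℕ) : ℕ := ∏ p ∈ Uset ps a e, p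

/-- `U ⊆ ps`. [folklore] -/
theorem Uset_subset (ps : List ℕ) (a : ℤ) (e : ℕ) : Uset ps a e ⊆ ps.toFinset := Finset.filter_subset _ _

/-- `U` depends only on the valuations at the primes of `ps`. [folklore] -/
theorem Uset_congr {ps : List ℕ} {a₁ a₂ : ℤ} {e₁ e₂ : ℕ}
    (he : ∀ q ∈ ps, padicValNat q e₁ = padicValNat q e₂)
    (ha : ∀ q ∈ ps, padicValNat q a₁.natAbs = padicValNat q a₂.natAbs) :
    Uset ps a₁ e₁ = Uset ps a₂ e₂ := by
  unfold Uset
  refine Finset.filter_congr fun q hq => ?_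
  rw [List.mem_toFinset] at hq
  rw [he q hq, ha q hq]

/-- `E` depends only on the valuations at the primes of `ps`. [folklore] -/
theorem Ered_congr {ps : List ℕ} {a₁ a₂ : ℤ} {e₁ e₂ : ℕ}
    (he : ∀ q ∈ ps, padicValNat q e₁ = padicValNat q e₂)
    (ha : ∀ q ∈ ps, padicValNat q a₁.natAbs = padicValNat q a₂.natAbs) :
    Ered ps a₁ e₁ = Ered ps a₂ e₂ := by
  unfold Ered
  rw [Uset_congr he ha]
  refine Finset.prod_congr rfl fun q hq => ?_
  rw [ha q (List.mem_toFinset.1 (Uset_subset _ _ _ hq))]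

/-- `P` depends only on the valuations at the primes of `ps`. [folklore] -/
theorem Pred_congr {ps : List ℕ} {a₁ a₂ : ℤ} {e₁ e₂ : ℕ}
    (he : ∀ q ∈ ps, padicValNat q e₁ = padicValNat q e₂)
    (ha : ∀ q ∈ ps, padicValNat q a₁.natAbs = padicValNat q a₂.natAbs) :
    Pred ps a₁ e₁ = Pred ps a₂ e₂ := by
  unfold Pred; rw [Uset_congr he ha]

/-- `U(p :: ps) = insert p U(ps)` at a `U`-prime `p`. [folklore] -/
theorem Uset_cons_of_eq {p : ℕ} {ps : List ℕ} {a : ℤ} {e : ℕ}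
    (h : padicValNat p e = padicValNat p a.natAbs + 1) :
    Uset (p :: ps) a e = insert p (Uset ps a e) := by
  unfold Uset
  rw [List.toFinset_cons, Finset.filter_insert, if_pos h]

/-- `U(p :: ps) = U(ps)` at a `G`-prime `p`. [folklore] -/
theorem Uset_cons_of_ne {p : ℕ} {ps : List ℕ} {a : ℤ} {e : ℕ}
    (h : padicValNat p e ≠ padicValNat p a.natAbs + 1) :
    Uset (p :: ps) a e = Uset ps a e := by
  unfold Uset
  rw [List.toFinset_cons, Finset.filter_insert, if_neg h]

/-- `E(p :: ps) = p^{v_p a} E(ps)` at a `U`-prime `p ∉ ps`. [folklore] -/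
theorem Ered_cons_of_eq {p : ℕ} {ps : List ℕ} (hp : p ∉ ps) {a : ℤ} {e : ℕ}
    (h : padicValNat p e = padicValNat p a.natAbs + 1) :
    Ered (p :: ps) a e = p ^ padicValNat p a.natAbs * Ered ps a e := by
  unfold Ered
  rw [Uset_cons_of_eq h, Finset.prod_insert]
  exact fun hm => hp (List.mem_toFinset.1 (Uset_subset _ _ _ hm))

/-- `P(p :: ps) = p · P(ps)` at a `U`-prime `p ∉ ps`. [folklore] -/
theorem Pred_cons_of_eq {p : ℕ} {ps : List ℕ} (hp : p ∉ ps) {a : ℤ} {e : ℕ}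
    (h : padicValNat p e = padicValNat p a.natAbs + 1) :
    Pred (p :: ps) a e = p * Pred ps a e := by
  unfold Pred
  rw [Uset_cons_of_eq h, Finset.prod_insert]
  exact fun hm => hp (List.mem_toFinset.1 (Uset_subset _ _ _ hm))

/-- `E(p :: ps) = E(ps)` at a `G`-prime `p`. [folklore] -/
theorem Ered_cons_of_ne {p : ℕ} {ps : List ℕ} {a : ℤ} {e : ℕ}
    (h : padicValNat p e ≠ padicValNat p a.natAbs + 1) : Ered (p :: ps) a e = Ered ps a e := by
  unfold Ered; rw [Uset_cons_of_ne h]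

/-- `P(p :: ps) = P(ps)` at a `G`-prime `p`. [folklore] -/
theorem Pred_cons_of_ne {p : ℕ} {ps : List ℕ} {a : ℤ} {e : ℕ}
    (h : padicValNat p e ≠ padicValNat p a.natAbs + 1) : Pred (p :: ps) a e = Pred ps a e := by
  unfold Pred; rw [Uset_cons_of_ne h]

/-- `E([]) = 1`. [folklore] -/
@[simp] theorem Ered_nil (a : ℤ) (e : ℕ) : Ered [] a e = 1 := by
  unfold Ered Uset; simp

/-- `P([]) = 1`. [folklore] -/
@[simp] theorem Pred_nil (a : ℤ) (e : ℕ) : Pred [] a e = 1 := by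
  unfold Pred Uset; simp

/-- `E > 0`. [folklore] -/
theorem Ered_pos {ps : List ℕ} (hpr : ∀ p ∈ ps, p.Prime) (a : ℤ) (e : ℕ) : 0 < Ered ps a e :=
  Finset.prod_pos fun p hp => pow_pos (hpr p (List.mem_toFinset.1 (Uset_subset _ _ _ hp))).pos _

/-- `P > 0`. [folklore] -/
theorem Pred_pos {ps : List ℕ} (hpr : ∀ p ∈ ps, p.Prime) (a : ℤ) (e : ℕ) : 0 < Pred ps a e :=
  Finset.prod_pos fun p hp => (hpr p (List.mem_toFinset.1 (Uset_subset _ _ _ hp))).pos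

/-! ### The terms of the full reduction -/

/-- The contribution of one term `t = (c, Dm, Dn)` of the reduction to the COUNT. [folklore] -/
def termA (a : ℤ) (z : ℝ) (SM SN : Finset ℕ) (l L₀ w₀ : ℕ) (lo hi : ℤ) (E P : ℕ) (t : ℤ × ℕ × ℕ) : ℝ :=
  (t.1 : ℝ) * (roughIndicator z t.2.1 * roughIndicator z t.2.2) *
    gcount (a / (E : ℤ)) z (sdiv SM t.2.1) (sdiv SN t.2.2) (l * t.2.1 * t.2.2 / E) (L₀ * t.2.1 * t.2.2)
      (P * w₀) lo hi

/-- The contribution of one term `t = (c, Dm, Dn)` of the reduction to the MODEL. [folklore] -/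
def termB (a : ℤ) (z : ℝ) (SM SN : Finset ℕ) (l L₀ w₀ : ℕ) (lo hi : ℤ) (E P : ℕ) (t : ℤ × ℕ × ℕ) : ℝ :=
  (t.1 : ℝ) * (roughIndicator z t.2.1 * roughIndicator z t.2.2) *
    gmodel (a / (E : ℤ)) z (sdiv SM t.2.1) (sdiv SN t.2.2) (l * t.2.1 * t.2.2 / E) (L₀ * t.2.1 * t.2.2)
      (P * w₀) lo hi

/-- Sum over a `flatMap`. [folklore] -/
theorem sum_map_flatMap {α β : Type*} (L : List α) (g : α → List β) (f : β → ℝ) :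
    ((L.flatMap g).map f).sum = (L.map (fun x => ((g x).map f).sum)).sum := by
  induction L with
  | nil => simp
  | cons x L ih => simp [List.flatMap_cons, List.map_append, List.sum_append, ih]

/-- Length of a `flatMap` with blocks of constant length. [folklore] -/
theorem length_flatMap_const {α β : Type*} (L : List α) (g : α → List β) {k : ℕ}
    (h : ∀ x ∈ L, (g x).length = k) : (L.flatMap g).length = L.length * k := by
  induction L with
  | nil => simp
  | cons x L ih =>
    rw [List.flatMap_cons, List.length_append, h x (List.mem_cons_self), List.length_cons,
      ih (fun y hy => h y (List.mem_cons_of_mem x hy))]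
    ring

/-- `(T.map (c • f)).sum = c * (T.map f).sum`. [folklore] -/
theorem sum_map_const_mul {β : Type*} (T : List β) (c : ℝ) (f : β → ℝ) :
    (T.map (fun t => c * f t)).sum = c * (T.map f).sum := by
  induction T with
  | nil => simp
  | cons x T ih => simp [ih, mul_add]


/-- Degenerate `U`-configuration for the model with an arbitrary cofactor. [folklore] -/
theorem gmodel_eq_zero_of_lt' {p : ℕ} (hp : p.Prime) {a : ℤ} (ha : a ≠ 0) {w' : ℕ} (hw'0 : w' ≠ 0)
    (z : ℝ) {SM SN : Finset ℕ} (hSM : ∀ m ∈ SM, 0 < m) (hSN : ∀ n ∈ SN, 0 < n) {lc : ℕ} (hlc : lc ≠ 0)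
    (hi : padicValNat p a.natAbs < padicValNat p lc) (L₀ : ℕ) (lo hi' : ℤ) :
    gmodel a z SM SN lc L₀ (p ^ (padicValNat p a.natAbs + 1) * w') lo hi' = 0 := by
  obtain ⟨v, w'', hw'', hdec⟩ := Nat.exists_eq_pow_mul_and_not_dvd hw'0 p hp.ne_one
  have hcop : Nat.Coprime p w'' := (Nat.Prime.coprime_iff_not_dvd hp).2 hw''
  have e1 : p ^ (padicValNat p a.natAbs + 1) * w' = p ^ (padicValNat p a.natAbs + 1 + v) * w'' := by
    rw [hdec, pow_add]; ring
  rw [e1]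
  exact gmodel_eq_zero_of_lt hp ha (by omega) hcop z hSM hSN hlc hi L₀ lo hi'

/-! ### The full reduction: statement and the three cases of the induction -/

/-- **The property delivered by the reduction** for the list of primes `ps`, the shift `a`, the
`a`-part `e` of the modulus and the (capped) valuation profile `prof` of the coefficient `l`:
a list `T` of signed terms `(c, Dm, Dn)` — at most `∏_p (2v_p(a)+3)` of them, `c = ±1`,
`Dm Dn ∣ ∏_p p^{v_p(a)+1}` — such that for every `l` with the profile `prof`, every cofactor `w₀`
free of the primes `p` with `v_p(e) ≤ v_p(a)`, all ranges of positive integers and all windows,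
`gcount(a; SM, SN; l, L₀; e·w₀) = ∑_{(c,Dm,Dn) ∈ T} c ρ(Dm)ρ(Dn) gcount(a/E; SM/Dm, SN/Dn; l·Dm·Dn/E, L₀·Dm·Dn; P·w₀)`
and the same for `gmodel`, where `E = BFI.Ered`, `P = BFI.Pred` and `E ∣ l Dm Dn`. [folklore] -/
def RedProp (ps : List ℕ) (a : ℤ) (e : ℕ) (prof : ℕ → ℕ) (T : List (ℤ × ℕ × ℕ)) : Prop :=
  T.length ≤ ∏ p ∈ ps.toFinset, (2 * padicValNat p a.natAbs + 3) ∧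
  (∀ t ∈ T, (t.1 = 1 ∨ t.1 = -1) ∧ 0 < t.2.1 ∧ 0 < t.2.2 ∧
     t.2.1 * t.2.2 ∣ ∏ p ∈ ps.toFinset, p ^ (padicValNat p a.natAbs + 1)) ∧
  ∀ l : ℕ, 0 < l → (∀ p ∈ ps, min (padicValNat p l) (padicValNat p a.natAbs + 1) = prof p) →
    (∀ t ∈ T, Ered ps a e ∣ l * t.2.1 * t.2.2) ∧
    ∀ (z : ℝ) (SM SN : Finset ℕ) (L₀ : ℕ) (lo hi : ℤ) (w₀ : ℕ),
      (∀ m ∈ SM, 0 < m) → (∀ n ∈ SN, 0 < n) → 0 < w₀ →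
      (∀ p ∈ ps, padicValNat p e ≤ padicValNat p a.natAbs → ¬ p ∣ w₀) →
      gcount a z SM SN l L₀ (e * w₀) lo hi =
        (T.map (termA a z SM SN l L₀ w₀ lo hi (Ered ps a e) (Pred ps a e))).sum ∧
      gmodel a z SM SN l L₀ (e * w₀) lo hi =
        (T.map (termB a z SM SN l L₀ w₀ lo hi (Ered ps a e) (Pred ps a e))).sum

/-- The base case: no primes, `e = 1`, one term. [folklore] -/
theorem red_nil (a : ℤ) {e : ℕ} (he : 0 < e) (hprimes : ∀ q : ℕ, q.Prime → q ∣ e → q ∈ ([] : List ℕ))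
    (prof : ℕ → ℕ) : ∃ T, RedProp [] a e prof T := by
  have he1 : e = 1 := by
    by_contra h
    obtain ⟨q, hq, hqe⟩ := Nat.exists_prime_and_dvd h
    exact List.not_mem_nil (hprimes q hq hqe)
  subst he1
  refine ⟨[((1 : ℤ), (1 : ℕ), (1 : ℕ))], by simp, ?_, ?_⟩
  · intro t ht
    rw [List.mem_singleton] at ht
    subst ht
    simp
  · intro l hl _
    refine ⟨fun t _ => by simp, ?_⟩
    intro z SM SN L₀ lo hi w₀ _ _ _ _
    simp [termA, termB, roughIndicator_one]

/-- The `U`-case of the induction step: `p^{v_p(a)+1} ∥ e`. [folklore] -/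
theorem red_cons_U {p : ℕ} {ps : List ℕ} (hp : p.Prime) (hpps : p ∉ ps) (hpr : ∀ q ∈ ps, q.Prime)
    {a : ℤ} (ha : a ≠ 0) {e : ℕ} (he : 0 < e) (hU : padicValNat p e = padicValNat p a.natAbs + 1)
    (prof : ℕ → ℕ)
    (IH : ∃ T', RedProp ps (a / (p : ℤ) ^ padicValNat p a.natAbs)
      (e / p ^ (padicValNat p a.natAbs + 1)) prof T') :
    ∃ T, RedProp (p :: ps) a e prof T := by
  haveI := Fact.mk hp
  set α := padicValNat p a.natAbs with hα
  -- `e = p^{α+1} e'`, `p ∤ e'`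
  set e' := e / p ^ (α + 1) with he'def
  have hediv : p ^ (α + 1) ∣ e := hU ▸ pow_padicValNat_dvd
  have he' : e = p ^ (α + 1) * e' := (Nat.mul_div_cancel' hediv).symm
  have he'0 : 0 < e' := Nat.pos_of_ne_zero fun h => by rw [h, mul_zero] at he'; exact he.ne' he'
  have hpe' : ¬ p ∣ e' := by
    intro h
    have : p ^ (padicValNat p e + 1) ∣ e := by
      rw [hU, he', pow_succ]; exact mul_dvd_mul_left _ h
    exact pow_succ_padicValNat_not_dvd he.ne' this
  -- valuations at the other primes
  have hne : ∀ q ∈ ps, q ≠ p := fun q hq h => hpps (h ▸ hq)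
  have hve : ∀ q ∈ ps, padicValNat q e = padicValNat q e' := by
    intro q hq
    rw [he', padicValNat_pow_mul_of_ne hp (hpr q hq) (hne q hq) _ he'0.ne']
  obtain ⟨ha'0, hva', habs⟩ := div_padic_facts hp ha
  set a' := a / (p : ℤ) ^ α with ha'def
  have hva : ∀ q ∈ ps, padicValNat q a.natAbs = padicValNat q a'.natAbs := fun q hq =>
    (padicValNat_natAbs_div_of_ne hp (hpr q hq) (hne q hq) ha).symm
  have hEq : Ered ps a e = Ered ps a' e' := Ered_congr hve hva
  have hPq : Pred ps a e = Pred ps a' e' := Pred_congr hve hva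
  have hE : Ered (p :: ps) a e = p ^ α * Ered ps a' e' := by rw [Ered_cons_of_eq hpps hU, hEq]
  have hP : Pred (p :: ps) a e = p * Pred ps a' e' := by rw [Pred_cons_of_eq hpps hU, hPq]
  have hprodB : ∏ q ∈ (p :: ps).toFinset, (2 * padicValNat q a.natAbs + 3) =
      (2 * α + 3) * ∏ q ∈ ps.toFinset, (2 * padicValNat q a'.natAbs + 3) := by
    rw [List.toFinset_cons, Finset.prod_insert (fun h => hpps (List.mem_toFinset.1 h))]
    congr 1
    exact Finset.prod_congr rfl fun q hq => by rw [hva q (List.mem_toFinset.1 hq)]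
  have hprodD : ∏ q ∈ (p :: ps).toFinset, q ^ (padicValNat q a.natAbs + 1) =
      p ^ (α + 1) * ∏ q ∈ ps.toFinset, q ^ (padicValNat q a'.natAbs + 1) := by
    rw [List.toFinset_cons, Finset.prod_insert (fun h => hpps (List.mem_toFinset.1 h))]
    congr 1
    exact Finset.prod_congr rfl fun q hq => by rw [hva q (List.mem_toFinset.1 hq)]
  obtain ⟨T', hlen', hterm', hmain'⟩ := IH
  set i₀ := prof p with hi₀
  by_cases hiα : i₀ ≤ α
  · -- the main case
    set g : ℕ → ℤ × ℕ × ℕ → ℤ × ℕ × ℕ := fun j t' => (t'.1, p ^ j * t'.2.1, p ^ (α - i₀ - j) * t'.2.2)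
      with hg
    set T : List (ℤ × ℕ × ℕ) := (range (α - i₀ + 1)).toList.flatMap (fun j => T'.map (g j)) with hT
    have hmemT : ∀ t ∈ T, ∃ j, j ≤ α - i₀ ∧ ∃ t' ∈ T', t = g j t' := by
      intro t ht
      rw [hT, List.mem_flatMap] at ht
      obtain ⟨j, hj, ht⟩ := ht
      rw [Finset.mem_toList, Finset.mem_range] at hj
      rw [List.mem_map] at ht
      obtain ⟨t', ht', rfl⟩ := ht
      exact ⟨j, by omega, t', ht', rfl⟩
    refine ⟨T, ?_, ?_, ?_⟩
    · -- length
      have hlenT : T.length = (α - i₀ + 1) * T'.length := by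
        rw [hT, length_flatMap_const _ _ (fun j _ => List.length_map _), Finset.length_toList,
          Finset.card_range]
      rw [hlenT, hprodB]
      exact Nat.mul_le_mul (by omega) hlen'
    · -- the terms
      intro t ht
      obtain ⟨j, hj, t', ht', rfl⟩ := hmemT t ht
      obtain ⟨hs, hDm, hDn, hdvd⟩ := hterm' t' ht'
      refine ⟨hs, mul_pos (pow_pos hp.pos _) hDm, mul_pos (pow_pos hp.pos _) hDn, ?_⟩
      rw [hprodD]
      have : p ^ j * t'.2.1 * (p ^ (α - i₀ - j) * t'.2.2) = p ^ (α - i₀) * (t'.2.1 * t'.2.2) := by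
        have : p ^ (α - i₀) = p ^ j * p ^ (α - i₀ - j) := by rw [← pow_add]; congr 1; omega
        rw [this]; ring
      rw [this]
      exact mul_dvd_mul (pow_dvd_pow p (by omega)) hdvd
    · -- the identities
      intro l hl hclass
      have hvl : padicValNat p l = i₀ := by
        have := hclass p List.mem_cons_self
        rw [← hi₀] at this
        rcases min_choice (padicValNat p l) (α + 1) with h | h <;> rw [h] at this <;> omega
      set l' := l / p ^ i₀ with hl'def
      have hldiv : p ^ i₀ ∣ l := hvl ▸ pow_padicValNat_dvd
      have hl' : l = p ^ i₀ * l' := (Nat.mul_div_cancel' hldiv).symm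
      have hl'0 : 0 < l' := Nat.pos_of_ne_zero fun h => by rw [h, mul_zero] at hl'; exact hl.ne' hl'
      have hclass' : ∀ q ∈ ps, min (padicValNat q l') (padicValNat q a'.natAbs + 1) = prof q := by
        intro q hq
        rw [hl'def, padicValNat_div_pow_of_ne hp (hpr q hq) (hne q hq) hl.ne' hldiv, ← hva q hq]
        exact hclass q (List.mem_cons_of_mem p hq)
      obtain ⟨hE', hid'⟩ := hmain' l' hl'0 hclass'
      -- the product `l Dm Dn` of a combined term
      have hlDD : ∀ j, j ≤ α - i₀ → ∀ t' : ℤ × ℕ × ℕ,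
          l * (p ^ j * t'.2.1) * (p ^ (α - i₀ - j) * t'.2.2) = p ^ α * (l' * t'.2.1 * t'.2.2) := by
        intro j hj t'
        have : p ^ α = p ^ i₀ * p ^ j * p ^ (α - i₀ - j) := by
          rw [← pow_add, ← pow_add]; congr 1; omega
        rw [this, hl']; ring
      refine ⟨?_, ?_⟩
      · intro t ht
        obtain ⟨j, hj, t', ht', rfl⟩ := hmemT t ht
        rw [hE]
        show p ^ α * Ered ps a' e' ∣ l * (p ^ j * t'.2.1) * (p ^ (α - i₀ - j) * t'.2.2)
        rw [hlDD j hj t']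
        exact mul_dvd_mul_left _ (hE' t' ht')
      intro z SM SN L₀ lo hi w₀ hSM hSN hw₀ hcopr
      -- hypotheses for the inner instances
      have hcopr' : ∀ q ∈ ps, padicValNat q e' ≤ padicValNat q a'.natAbs → ¬ q ∣ p * w₀ := by
        intro q hq hqe hdvd
        have hq := hpr q hq
        rcases (Nat.Prime.dvd_mul hq).1 hdvd with h | h
        · exact hne q ‹q ∈ ps› ((Nat.prime_dvd_prime_iff_eq hq hp).1 h)
        · exact hcopr q (List.mem_cons_of_mem p ‹q ∈ ps›) (by rw [hve q ‹q ∈ ps›, hva q ‹q ∈ ps›]; exact hqe) h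
      have hpw₀ : 0 < p * w₀ := mul_pos hp.pos hw₀
      have hew : e * w₀ = p ^ (α + 1) * (e' * w₀) := by rw [he']; ring
      have hew' : p * (e' * w₀) = e' * (p * w₀) := by ring
      have hvi : padicValNat p l ≤ padicValNat p a.natAbs := by rw [hvl]; exact hiα
      -- termwise comparison
      have hterms : ∀ j, j ≤ α - i₀ → ∀ t' ∈ T',
          termA a z SM SN l L₀ w₀ lo hi (Ered (p :: ps) a e) (Pred (p :: ps) a e) (g j t') =
            roughIndicator z (p ^ j) * roughIndicator z (p ^ (α - i₀ - j)) *
              termA a' z (sdiv SM (p ^ j)) (sdiv SN (p ^ (α - i₀ - j))) l'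
                (L₀ * p ^ j * p ^ (α - i₀ - j)) (p * w₀) lo hi (Ered ps a' e') (Pred ps a' e') t' ∧
          termB a z SM SN l L₀ w₀ lo hi (Ered (p :: ps) a e) (Pred (p :: ps) a e) (g j t') =
            roughIndicator z (p ^ j) * roughIndicator z (p ^ (α - i₀ - j)) *
              termB a' z (sdiv SM (p ^ j)) (sdiv SN (p ^ (α - i₀ - j))) l'
                (L₀ * p ^ j * p ^ (α - i₀ - j)) (p * w₀) lo hi (Ered ps a' e') (Pred ps a' e') t' := by
        intro j hj t' ht'
        obtain ⟨-, hDm, hDn, -⟩ := hterm' t' ht'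
        have hpj : (p ^ j) ≠ 0 := pow_ne_zero _ hp.ne_zero
        have hpk : (p ^ (α - i₀ - j)) ≠ 0 := pow_ne_zero _ hp.ne_zero
        have eρm : roughIndicator z (p ^ j * t'.2.1) = roughIndicator z (p ^ j) * roughIndicator z t'.2.1 :=
          roughIndicator_mul hpj hDm.ne' z
        have eρn : roughIndicator z (p ^ (α - i₀ - j) * t'.2.2) =
            roughIndicator z (p ^ (α - i₀ - j)) * roughIndicator z t'.2.2 :=
          roughIndicator_mul hpk hDn.ne' z
        have ea : a / ((Ered (p :: ps) a e : ℕ) : ℤ) = a' / ((Ered ps a' e' : ℕ) : ℤ) := by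
          rw [hE, Nat.cast_mul, Nat.cast_pow, ha'def, Int.ediv_ediv_of_nonneg (by positivity)]
        have eSM : sdiv SM (p ^ j * t'.2.1) = sdiv (sdiv SM (p ^ j)) t'.2.1 :=
          (sdiv_sdiv SM (pow_pos hp.pos _) hDm).symm
        have eSN : sdiv SN (p ^ (α - i₀ - j) * t'.2.2) = sdiv (sdiv SN (p ^ (α - i₀ - j))) t'.2.2 :=
          (sdiv_sdiv SN (pow_pos hp.pos _) hDn).symm
        have el : l * (p ^ j * t'.2.1) * (p ^ (α - i₀ - j) * t'.2.2) / Ered (p :: ps) a e =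
            l' * t'.2.1 * t'.2.2 / Ered ps a' e' := by
          rw [hlDD j hj t', hE, Nat.mul_div_mul_left _ _ (pow_pos hp.pos α)]
        have eL : L₀ * (p ^ j * t'.2.1) * (p ^ (α - i₀ - j) * t'.2.2) =
            L₀ * p ^ j * p ^ (α - i₀ - j) * t'.2.1 * t'.2.2 := by ring
        have eP : Pred (p :: ps) a e * w₀ = Pred ps a' e' * (p * w₀) := by rw [hP]; ring
        constructor
        · unfold termA
          simp only [hg]
          rw [eρm, eρn, ea, eSM, eSN, el, eL, eP]; ring
        · unfold termB
          simp only [hg]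
          rw [eρm, eρn, ea, eSM, eSN, el, eL, eP]; ring
      -- assemble
      have hsumA : (T.map (termA a z SM SN l L₀ w₀ lo hi (Ered (p :: ps) a e) (Pred (p :: ps) a e))).sum =
          ∑ j ∈ range (α - i₀ + 1), roughIndicator z (p ^ j) * roughIndicator z (p ^ (α - i₀ - j)) *
            (T'.map (termA a' z (sdiv SM (p ^ j)) (sdiv SN (p ^ (α - i₀ - j))) l'
              (L₀ * p ^ j * p ^ (α - i₀ - j)) (p * w₀) lo hi (Ered ps a' e') (Pred ps a' e'))).sum := by
        rw [hT, sum_map_flatMap, Finset.sum_map_toList]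
        refine Finset.sum_congr rfl fun j hj => ?_
        have hj' : j ≤ α - i₀ := by have := Finset.mem_range.1 hj; omega
        rw [List.map_map, ← sum_map_const_mul]
        congr 1
        refine List.map_congr_left fun t' ht' => ?_
        exact (hterms j hj' t' ht').1
      have hsumB : (T.map (termB a z SM SN l L₀ w₀ lo hi (Ered (p :: ps) a e) (Pred (p :: ps) a e))).sum =
          ∑ j ∈ range (α - i₀ + 1), roughIndicator z (p ^ j) * roughIndicator z (p ^ (α - i₀ - j)) *
            (T'.map (termB a' z (sdiv SM (p ^ j)) (sdiv SN (p ^ (α - i₀ - j))) l'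
              (L₀ * p ^ j * p ^ (α - i₀ - j)) (p * w₀) lo hi (Ered ps a' e') (Pred ps a' e'))).sum := by
        rw [hT, sum_map_flatMap, Finset.sum_map_toList]
        refine Finset.sum_congr rfl fun j hj => ?_
        have hj' : j ≤ α - i₀ := by have := Finset.mem_range.1 hj; omega
        rw [List.map_map, ← sum_map_const_mul]
        congr 1
        refine List.map_congr_left fun t' ht' => ?_
        exact (hterms j hj' t' ht').2
      constructor
      · rw [hsumA, hew, gcount_step_U' hp ha (e' * w₀) z hSM hSN hl.ne' hvi L₀ lo hi, hvl]
        refine Finset.sum_congr rfl fun j _ => ?_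
        rw [hew', (hid' z _ _ _ lo hi (p * w₀) (sdiv_pos hSM (pow_pos hp.pos _))
          (sdiv_pos hSN (pow_pos hp.pos _)) hpw₀ hcopr').1]
      · rw [hsumB, hew, gmodel_step_U' hp ha (mul_ne_zero he'0.ne' hw₀.ne') z hSM hSN hl.ne' hvi L₀ lo hi,
          hvl]
        refine Finset.sum_congr rfl fun j _ => ?_
        rw [hew', (hid' z _ _ _ lo hi (p * w₀) (sdiv_pos hSM (pow_pos hp.pos _))
          (sdiv_pos hSN (pow_pos hp.pos _)) hpw₀ hcopr').2]
  · -- the degenerate case `prof p > α`: every `l` of the class has `v_p(l) > α`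
    refine ⟨[], by simp, fun t ht => absurd ht List.not_mem_nil, ?_⟩
    intro l hl hclass
    have hvl : α < padicValNat p l := by
      have := hclass p List.mem_cons_self
      rw [← hi₀] at this
      rcases min_choice (padicValNat p l) (α + 1) with h | h <;> rw [h] at this <;> omega
    refine ⟨fun t ht => absurd ht List.not_mem_nil, ?_⟩
    intro z SM SN L₀ lo hi w₀ hSM hSN hw₀ _
    have hew : e * w₀ = p ^ (α + 1) * (e' * w₀) := by rw [he']; ring
    rw [List.map_nil, List.map_nil, List.sum_nil, hew,
      gcount_eq_zero_of_lt hp ha (Nat.lt_succ_self α) (e' * w₀) z hSM hSN hl.ne' hvl L₀ lo hi,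
      gmodel_eq_zero_of_lt' hp ha (mul_ne_zero he'0.ne' hw₀.ne') z hSM hSN hl.ne' hvl L₀ lo hi]
    exact ⟨rfl, rfl⟩


/-- The `G`-case of the induction step: `v_p(e) ≤ v_p(a)`. [folklore] -/
theorem red_cons_G {p : ℕ} {ps : List ℕ} (hp : p.Prime) (hpps : p ∉ ps) (hpr : ∀ q ∈ ps, q.Prime)
    {a : ℤ} {e : ℕ} (he : 0 < e) (hG : padicValNat p e ≤ padicValNat p a.natAbs)
    (prof : ℕ → ℕ) (IH : ∃ T', RedProp ps a (e / p ^ padicValNat p e) prof T') :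
    ∃ T, RedProp (p :: ps) a e prof T := by
  haveI := Fact.mk hp
  set α := padicValNat p a.natAbs with hα
  set ω := padicValNat p e with hω
  have hGne : padicValNat p e ≠ padicValNat p a.natAbs + 1 := by rw [← hω, ← hα]; omega
  -- `e = p^ω e'`, `p ∤ e'`
  set e' := e / p ^ ω with he'def
  have hediv : p ^ ω ∣ e := pow_padicValNat_dvd
  have he' : e = p ^ ω * e' := (Nat.mul_div_cancel' hediv).symm
  have he'0 : 0 < e' := Nat.pos_of_ne_zero fun h => by rw [h, mul_zero] at he'; exact he.ne' he'
  have hpe' : ¬ p ∣ e' := by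
    intro h
    have : p ^ (padicValNat p e + 1) ∣ e := by
      rw [← hω, he', pow_succ]; exact mul_dvd_mul_left _ h
    exact pow_succ_padicValNat_not_dvd he.ne' this
  have hne : ∀ q ∈ ps, q ≠ p := fun q hq h => hpps (h ▸ hq)
  have hve : ∀ q ∈ ps, padicValNat q e = padicValNat q e' := by
    intro q hq
    rw [he', padicValNat_pow_mul_of_ne hp (hpr q hq) (hne q hq) _ he'0.ne']
  have hEq : Ered ps a e = Ered ps a e' := Ered_congr hve (fun _ _ => rfl)
  have hPq : Pred ps a e = Pred ps a e' := Pred_congr hve (fun _ _ => rfl)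
  have hE : Ered (p :: ps) a e = Ered ps a e' := by rw [Ered_cons_of_ne hGne, hEq]
  have hP : Pred (p :: ps) a e = Pred ps a e' := by rw [Pred_cons_of_ne hGne, hPq]
  have hprodB : ∏ q ∈ (p :: ps).toFinset, (2 * padicValNat q a.natAbs + 3) =
      (2 * α + 3) * ∏ q ∈ ps.toFinset, (2 * padicValNat q a.natAbs + 3) := by
    rw [List.toFinset_cons, Finset.prod_insert (fun h => hpps (List.mem_toFinset.1 h))]
  have hprodD : ∏ q ∈ (p :: ps).toFinset, q ^ (padicValNat q a.natAbs + 1) =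
      p ^ (α + 1) * ∏ q ∈ ps.toFinset, q ^ (padicValNat q a.natAbs + 1) := by
    rw [List.toFinset_cons, Finset.prod_insert (fun h => hpps (List.mem_toFinset.1 h))]
  -- `p^ω ∣ a`
  have hpa : (p : ℤ) ^ ω ∣ a := by
    have h1 : p ^ ω ∣ a.natAbs := (pow_dvd_pow p hG).trans pow_padicValNat_dvd
    rw [← Int.natAbs_dvd_natAbs]; simpa [Int.natAbs_pow, Int.natAbs_natCast] using h1
  have hpaN : p ^ ω ∣ a.natAbs := (pow_dvd_pow p hG).trans pow_padicValNat_dvd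
  obtain ⟨T', hlen', hterm', hmain'⟩ := IH
  set i₀ := prof p with hi₀
  set t := ω - min ω i₀ with htdef
  have htω : t ≤ ω := Nat.sub_le _ _
  set g₁ : ℕ → ℤ × ℕ × ℕ → ℤ × ℕ × ℕ := fun j t' => (t'.1, p ^ (t - j) * t'.2.1, p ^ j * t'.2.2) with hg₁
  set g₂ : ℕ → ℤ × ℕ × ℕ → ℤ × ℕ × ℕ := fun j t' => (-t'.1, p ^ (t - j) * t'.2.1, p ^ (j + 1) * t'.2.2)
    with hg₂
  set T₁ : List (ℤ × ℕ × ℕ) := (range (t + 1)).toList.flatMap (fun j => T'.map (g₁ j)) with hT₁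
  set T₂ : List (ℤ × ℕ × ℕ) := (range t).toList.flatMap (fun j => T'.map (g₂ j)) with hT₂
  have hmem₁ : ∀ x ∈ T₁, ∃ j, j ≤ t ∧ ∃ t' ∈ T', x = g₁ j t' := by
    intro x hx
    rw [hT₁, List.mem_flatMap] at hx
    obtain ⟨j, hj, hx⟩ := hx
    rw [Finset.mem_toList, Finset.mem_range] at hj
    rw [List.mem_map] at hx
    obtain ⟨t', ht', rfl⟩ := hx
    exact ⟨j, by omega, t', ht', rfl⟩
  have hmem₂ : ∀ x ∈ T₂, ∃ j, j < t ∧ ∃ t' ∈ T', x = g₂ j t' := by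
    intro x hx
    rw [hT₂, List.mem_flatMap] at hx
    obtain ⟨j, hj, hx⟩ := hx
    rw [Finset.mem_toList, Finset.mem_range] at hj
    rw [List.mem_map] at hx
    obtain ⟨t', ht', rfl⟩ := hx
    exact ⟨j, hj, t', ht', rfl⟩
  refine ⟨T₁ ++ T₂, ?_, ?_, ?_⟩
  · -- length
    have h1 : T₁.length = (t + 1) * T'.length := by
      rw [hT₁, length_flatMap_const _ _ (fun j _ => List.length_map _), Finset.length_toList,
        Finset.card_range]
    have h2 : T₂.length = t * T'.length := by
      rw [hT₂, length_flatMap_const _ _ (fun j _ => List.length_map _), Finset.length_toList,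
        Finset.card_range]
    rw [List.length_append, h1, h2, hprodB]
    calc (t + 1) * T'.length + t * T'.length = (2 * t + 1) * T'.length := by ring
      _ ≤ (2 * α + 3) * ∏ q ∈ ps.toFinset, (2 * padicValNat q a.natAbs + 3) :=
          Nat.mul_le_mul (by omega) hlen'
  · -- the terms
    intro x hx
    rw [hprodD]
    rcases List.mem_append.1 hx with hx | hx
    · obtain ⟨j, hj, t', ht', rfl⟩ := hmem₁ x hx
      obtain ⟨hs, hDm, hDn, hdvd⟩ := hterm' t' ht'
      refine ⟨hs, mul_pos (pow_pos hp.pos _) hDm, mul_pos (pow_pos hp.pos _) hDn, ?_⟩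
      have : p ^ (t - j) * t'.2.1 * (p ^ j * t'.2.2) = p ^ t * (t'.2.1 * t'.2.2) := by
        have : p ^ t = p ^ (t - j) * p ^ j := by rw [← pow_add]; congr 1; omega
        rw [this]; ring
      rw [this]
      exact mul_dvd_mul (pow_dvd_pow p (by omega)) hdvd
    · obtain ⟨j, hj, t', ht', rfl⟩ := hmem₂ x hx
      obtain ⟨hs, hDm, hDn, hdvd⟩ := hterm' t' ht'
      refine ⟨by rcases hs with h | h <;> simp [hg₂, h], mul_pos (pow_pos hp.pos _) hDm,
        mul_pos (pow_pos hp.pos _) hDn, ?_⟩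
      have : p ^ (t - j) * t'.2.1 * (p ^ (j + 1) * t'.2.2) = p ^ (t + 1) * (t'.2.1 * t'.2.2) := by
        have : p ^ (t + 1) = p ^ (t - j) * p ^ (j + 1) := by rw [← pow_add]; congr 1; omega
        rw [this]; ring
      rw [this]
      exact mul_dvd_mul (pow_dvd_pow p (by omega)) hdvd
  · -- the identities
    intro l hl hclass
    have hvl : min ω (padicValNat p l) = min ω i₀ := by
      have := hclass p List.mem_cons_self
      rw [← hi₀] at this
      rw [← this, ← min_assoc,
        min_eq_left ((min_le_left _ _).trans (show ω ≤ padicValNat p a.natAbs + 1 by omega))]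
    have htl : ω - min ω (padicValNat p l) = t := by rw [hvl]
    have hclass₁ : ∀ q ∈ ps, min (padicValNat q (l * p ^ t)) (padicValNat q a.natAbs + 1) = prof q := by
      intro q hq
      rw [mul_comm, padicValNat_pow_mul_of_ne hp (hpr q hq) (hne q hq) _ hl.ne']
      exact hclass q (List.mem_cons_of_mem p hq)
    have hclass₂ : ∀ q ∈ ps, min (padicValNat q (l * p ^ (t + 1))) (padicValNat q a.natAbs + 1) = prof q := by
      intro q hq
      rw [mul_comm, padicValNat_pow_mul_of_ne hp (hpr q hq) (hne q hq) _ hl.ne']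
      exact hclass q (List.mem_cons_of_mem p hq)
    have hl₁ : 0 < l * p ^ t := mul_pos hl (pow_pos hp.pos _)
    have hl₂ : 0 < l * p ^ (t + 1) := mul_pos hl (pow_pos hp.pos _)
    obtain ⟨hE₁, hid₁⟩ := hmain' (l * p ^ t) hl₁ hclass₁
    obtain ⟨hE₂, hid₂⟩ := hmain' (l * p ^ (t + 1)) hl₂ hclass₂
    have hlDD₁ : ∀ j, j ≤ t → ∀ t' : ℤ × ℕ × ℕ,
        l * (p ^ (t - j) * t'.2.1) * (p ^ j * t'.2.2) = l * p ^ t * t'.2.1 * t'.2.2 := by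
      intro j hj t'
      have : p ^ t = p ^ (t - j) * p ^ j := by rw [← pow_add]; congr 1; omega
      rw [this]; ring
    have hlDD₂ : ∀ j, j < t → ∀ t' : ℤ × ℕ × ℕ,
        l * (p ^ (t - j) * t'.2.1) * (p ^ (j + 1) * t'.2.2) = l * p ^ (t + 1) * t'.2.1 * t'.2.2 := by
      intro j hj t'
      have : p ^ (t + 1) = p ^ (t - j) * p ^ (j + 1) := by rw [← pow_add]; congr 1; omega
      rw [this]; ring
    refine ⟨?_, ?_⟩
    · intro x hx
      rw [hE]
      rcases List.mem_append.1 hx with hx | hx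
      · obtain ⟨j, hj, t', ht', rfl⟩ := hmem₁ x hx
        show Ered ps a e' ∣ l * (p ^ (t - j) * t'.2.1) * (p ^ j * t'.2.2)
        rw [hlDD₁ j hj t']; exact hE₁ t' ht'
      · obtain ⟨j, hj, t', ht', rfl⟩ := hmem₂ x hx
        show Ered ps a e' ∣ l * (p ^ (t - j) * t'.2.1) * (p ^ (j + 1) * t'.2.2)
        rw [hlDD₂ j hj t']; exact hE₂ t' ht'
    intro z SM SN L₀ lo hi w₀ hSM hSN hw₀ hcopr
    have hpw₀ : ¬ p ∣ w₀ := hcopr p List.mem_cons_self hG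
    have hcop : Nat.Coprime p (e' * w₀) :=
      Nat.Coprime.mul_right ((Nat.Prime.coprime_iff_not_dvd hp).2 hpe')
        ((Nat.Prime.coprime_iff_not_dvd hp).2 hpw₀)
    have hcopr' : ∀ q ∈ ps, padicValNat q e' ≤ padicValNat q a.natAbs → ¬ q ∣ w₀ := by
      intro q hq hqe
      exact hcopr q (List.mem_cons_of_mem p hq) (by rw [hve q hq]; exact hqe)
    have hew : e * w₀ = p ^ ω * (e' * w₀) := by rw [he']; ring
    -- termwise comparison, first family
    have hterms₁ : ∀ j, j ≤ t → ∀ t' ∈ T',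
        termA a z SM SN l L₀ w₀ lo hi (Ered (p :: ps) a e) (Pred (p :: ps) a e) (g₁ j t') =
          roughIndicator z (p ^ (t - j)) * roughIndicator z (p ^ j) *
            termA a z (sdiv SM (p ^ (t - j))) (sdiv SN (p ^ j)) (l * p ^ t) (L₀ * p ^ t) w₀ lo hi
              (Ered ps a e') (Pred ps a e') t' ∧
        termB a z SM SN l L₀ w₀ lo hi (Ered (p :: ps) a e) (Pred (p :: ps) a e) (g₁ j t') =
          roughIndicator z (p ^ (t - j)) * roughIndicator z (p ^ j) *
            termB a z (sdiv SM (p ^ (t - j))) (sdiv SN (p ^ j)) (l * p ^ t) (L₀ * p ^ t) w₀ lo hi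
              (Ered ps a e') (Pred ps a e') t' := by
      intro j hj t' ht'
      obtain ⟨-, hDm, hDn, -⟩ := hterm' t' ht'
      have eρm : roughIndicator z (p ^ (t - j) * t'.2.1) =
          roughIndicator z (p ^ (t - j)) * roughIndicator z t'.2.1 :=
        roughIndicator_mul (pow_ne_zero _ hp.ne_zero) hDm.ne' z
      have eρn : roughIndicator z (p ^ j * t'.2.2) = roughIndicator z (p ^ j) * roughIndicator z t'.2.2 :=
        roughIndicator_mul (pow_ne_zero _ hp.ne_zero) hDn.ne' z
      have eSM : sdiv SM (p ^ (t - j) * t'.2.1) = sdiv (sdiv SM (p ^ (t - j))) t'.2.1 :=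
        (sdiv_sdiv SM (pow_pos hp.pos _) hDm).symm
      have eSN : sdiv SN (p ^ j * t'.2.2) = sdiv (sdiv SN (p ^ j)) t'.2.2 :=
        (sdiv_sdiv SN (pow_pos hp.pos _) hDn).symm
      have eL : L₀ * (p ^ (t - j) * t'.2.1) * (p ^ j * t'.2.2) = L₀ * p ^ t * t'.2.1 * t'.2.2 := by
        have : p ^ t = p ^ (t - j) * p ^ j := by rw [← pow_add]; congr 1; omega
        rw [this]; ring
      constructor
      · unfold termA; simp only [hg₁]; rw [eρm, eρn, hE, hP, eSM, eSN, hlDD₁ j hj t', eL]; ring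
      · unfold termB; simp only [hg₁]; rw [eρm, eρn, hE, hP, eSM, eSN, hlDD₁ j hj t', eL]; ring
    have hterms₂ : ∀ j, j < t → ∀ t' ∈ T',
        termA a z SM SN l L₀ w₀ lo hi (Ered (p :: ps) a e) (Pred (p :: ps) a e) (g₂ j t') =
          -(roughIndicator z (p ^ (t - j)) * roughIndicator z (p ^ (j + 1))) *
            termA a z (sdiv SM (p ^ (t - j))) (sdiv SN (p ^ (j + 1))) (l * p ^ (t + 1)) (L₀ * p ^ (t + 1))
              w₀ lo hi (Ered ps a e') (Pred ps a e') t' ∧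
        termB a z SM SN l L₀ w₀ lo hi (Ered (p :: ps) a e) (Pred (p :: ps) a e) (g₂ j t') =
          -(roughIndicator z (p ^ (t - j)) * roughIndicator z (p ^ (j + 1))) *
            termB a z (sdiv SM (p ^ (t - j))) (sdiv SN (p ^ (j + 1))) (l * p ^ (t + 1)) (L₀ * p ^ (t + 1))
              w₀ lo hi (Ered ps a e') (Pred ps a e') t' := by
      intro j hj t' ht'
      obtain ⟨-, hDm, hDn, -⟩ := hterm' t' ht'
      have eρm : roughIndicator z (p ^ (t - j) * t'.2.1) =
          roughIndicator z (p ^ (t - j)) * roughIndicator z t'.2.1 :=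
        roughIndicator_mul (pow_ne_zero _ hp.ne_zero) hDm.ne' z
      have eρn : roughIndicator z (p ^ (j + 1) * t'.2.2) =
          roughIndicator z (p ^ (j + 1)) * roughIndicator z t'.2.2 :=
        roughIndicator_mul (pow_ne_zero _ hp.ne_zero) hDn.ne' z
      have eSM : sdiv SM (p ^ (t - j) * t'.2.1) = sdiv (sdiv SM (p ^ (t - j))) t'.2.1 :=
        (sdiv_sdiv SM (pow_pos hp.pos _) hDm).symm
      have eSN : sdiv SN (p ^ (j + 1) * t'.2.2) = sdiv (sdiv SN (p ^ (j + 1))) t'.2.2 :=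
        (sdiv_sdiv SN (pow_pos hp.pos _) hDn).symm
      have eL : L₀ * (p ^ (t - j) * t'.2.1) * (p ^ (j + 1) * t'.2.2) = L₀ * p ^ (t + 1) * t'.2.1 * t'.2.2 := by
        have : p ^ (t + 1) = p ^ (t - j) * p ^ (j + 1) := by rw [← pow_add]; congr 1; omega
        rw [this]; ring
      constructor
      · unfold termA; simp only [hg₂, Int.cast_neg]
        rw [eρm, eρn, hE, hP, eSM, eSN, hlDD₂ j hj t', eL]; ring
      · unfold termB; simp only [hg₂, Int.cast_neg]
        rw [eρm, eρn, hE, hP, eSM, eSN, hlDD₂ j hj t', eL]; ring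
    -- the sums over `T₁` and `T₂`
    have hsum₁A : (T₁.map (termA a z SM SN l L₀ w₀ lo hi (Ered (p :: ps) a e) (Pred (p :: ps) a e))).sum =
        ∑ j ∈ range (t + 1), roughIndicator z (p ^ (t - j)) * roughIndicator z (p ^ j) *
          (T'.map (termA a z (sdiv SM (p ^ (t - j))) (sdiv SN (p ^ j)) (l * p ^ t) (L₀ * p ^ t) w₀ lo hi
            (Ered ps a e') (Pred ps a e'))).sum := by
      rw [hT₁, sum_map_flatMap, Finset.sum_map_toList]
      refine Finset.sum_congr rfl fun j hj => ?_
      have hj' : j ≤ t := by have := Finset.mem_range.1 hj; omega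
      rw [List.map_map, ← sum_map_const_mul]
      congr 1
      exact List.map_congr_left fun t' ht' => (hterms₁ j hj' t' ht').1
    have hsum₁B : (T₁.map (termB a z SM SN l L₀ w₀ lo hi (Ered (p :: ps) a e) (Pred (p :: ps) a e))).sum =
        ∑ j ∈ range (t + 1), roughIndicator z (p ^ (t - j)) * roughIndicator z (p ^ j) *
          (T'.map (termB a z (sdiv SM (p ^ (t - j))) (sdiv SN (p ^ j)) (l * p ^ t) (L₀ * p ^ t) w₀ lo hi
            (Ered ps a e') (Pred ps a e'))).sum := by
      rw [hT₁, sum_map_flatMap, Finset.sum_map_toList]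
      refine Finset.sum_congr rfl fun j hj => ?_
      have hj' : j ≤ t := by have := Finset.mem_range.1 hj; omega
      rw [List.map_map, ← sum_map_const_mul]
      congr 1
      exact List.map_congr_left fun t' ht' => (hterms₁ j hj' t' ht').2
    have hsum₂A : (T₂.map (termA a z SM SN l L₀ w₀ lo hi (Ered (p :: ps) a e) (Pred (p :: ps) a e))).sum =
        -∑ j ∈ range t, roughIndicator z (p ^ (t - j)) * roughIndicator z (p ^ (j + 1)) *
          (T'.map (termA a z (sdiv SM (p ^ (t - j))) (sdiv SN (p ^ (j + 1))) (l * p ^ (t + 1))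
            (L₀ * p ^ (t + 1)) w₀ lo hi (Ered ps a e') (Pred ps a e'))).sum := by
      rw [hT₂, sum_map_flatMap, Finset.sum_map_toList, ← Finset.sum_neg_distrib]
      refine Finset.sum_congr rfl fun j hj => ?_
      have hj' : j < t := Finset.mem_range.1 hj
      rw [List.map_map, neg_mul_eq_neg_mul, ← sum_map_const_mul]
      congr 1
      exact List.map_congr_left fun t' ht' => (hterms₂ j hj' t' ht').1
    have hsum₂B : (T₂.map (termB a z SM SN l L₀ w₀ lo hi (Ered (p :: ps) a e) (Pred (p :: ps) a e))).sum =
        -∑ j ∈ range t, roughIndicator z (p ^ (t - j)) * roughIndicator z (p ^ (j + 1)) *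
          (T'.map (termB a z (sdiv SM (p ^ (t - j))) (sdiv SN (p ^ (j + 1))) (l * p ^ (t + 1))
            (L₀ * p ^ (t + 1)) w₀ lo hi (Ered ps a e') (Pred ps a e'))).sum := by
      rw [hT₂, sum_map_flatMap, Finset.sum_map_toList, ← Finset.sum_neg_distrib]
      refine Finset.sum_congr rfl fun j hj => ?_
      have hj' : j < t := Finset.mem_range.1 hj
      rw [List.map_map, neg_mul_eq_neg_mul, ← sum_map_const_mul]
      congr 1
      exact List.map_congr_left fun t' ht' => (hterms₂ j hj' t' ht').2
    constructor
    · rw [List.map_append, List.sum_append, hsum₁A, hsum₂A, ← sub_eq_add_neg, hew,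
        gcount_step_G hp hpa hcop z hSM hSN hl.ne' L₀ lo hi, htl]
      congr 1
      · refine Finset.sum_congr rfl fun j _ => ?_
        rw [(hid₁ z _ _ _ lo hi w₀ (sdiv_pos hSM (pow_pos hp.pos _)) (sdiv_pos hSN (pow_pos hp.pos _))
          hw₀ hcopr').1]
      · refine Finset.sum_congr rfl fun j _ => ?_
        rw [(hid₂ z _ _ _ lo hi w₀ (sdiv_pos hSM (pow_pos hp.pos _)) (sdiv_pos hSN (pow_pos hp.pos _))
          hw₀ hcopr').1]
    · rw [List.map_append, List.sum_append, hsum₁B, hsum₂B, ← sub_eq_add_neg, hew,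
        gmodel_step_G hp hpaN hcop z hSM hSN hl.ne' L₀ lo hi, htl]
      congr 1
      · refine Finset.sum_congr rfl fun j _ => ?_
        rw [(hid₁ z _ _ _ lo hi w₀ (sdiv_pos hSM (pow_pos hp.pos _)) (sdiv_pos hSN (pow_pos hp.pos _))
          hw₀ hcopr').2]
      · refine Finset.sum_congr rfl fun j _ => ?_
        rw [(hid₂ z _ _ _ lo hi w₀ (sdiv_pos hSM (pow_pos hp.pos _)) (sdiv_pos hSN (pow_pos hp.pos _))
          hw₀ hcopr').2]

/-- **The `p`-adic reduction of the switched congruence counts to unit classes** (all primes of the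
`a`-part `e` of the modulus at once): see `BFI.RedProp`.
[cite: BombieriFriedlanderIwaniecActa1986, §13 p. 241–242] -/
theorem padic_reduction : ∀ (ps : List ℕ), ps.Nodup → (∀ p ∈ ps, p.Prime) →
    ∀ (a : ℤ), a ≠ 0 → ∀ (e : ℕ), 0 < e → (∀ q : ℕ, q.Prime → q ∣ e → q ∈ ps) →
    (∀ p ∈ ps, padicValNat p e ≤ padicValNat p a.natAbs + 1) →
    ∀ prof : ℕ → ℕ, ∃ T, RedProp ps a e prof T := by
  intro ps
  induction ps with
  | nil =>
    intro _ _ a _ e he hprimes _ prof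
    exact red_nil a he hprimes prof
  | cons p ps ih =>
    intro hnd hpr a ha e he hprimes hbound prof
    rw [List.nodup_cons] at hnd
    obtain ⟨hpps, hnd'⟩ := hnd
    have hp : p.Prime := hpr p List.mem_cons_self
    haveI := Fact.mk hp
    have hpr' : ∀ q ∈ ps, q.Prime := fun q hq => hpr q (List.mem_cons_of_mem p hq)
    have hne : ∀ q ∈ ps, q ≠ p := fun q hq h => hpps (h ▸ hq)
    have hbp := hbound p List.mem_cons_self
    -- the `p`-free part of `e`
    have key : ∀ k : ℕ, p ^ k ∣ e → ¬ p ∣ e / p ^ k →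
        0 < e / p ^ k ∧ (∀ q : ℕ, q.Prime → q ∣ e / p ^ k → q ∈ ps) ∧
        (∀ q ∈ ps, padicValNat q (e / p ^ k) = padicValNat q e) := by
      intro k hk hnot
      have hdec : e = p ^ k * (e / p ^ k) := (Nat.mul_div_cancel' hk).symm
      have hpos : 0 < e / p ^ k := Nat.pos_of_ne_zero fun h => by
        rw [h, mul_zero] at hdec; exact he.ne' hdec
      refine ⟨hpos, ?_, ?_⟩
      · intro q hq hqe
        have hqe' : q ∣ e := hqe.trans (Nat.div_dvd_of_dvd hk)
        rcases List.mem_cons.1 (hprimes q hq hqe') with h | h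
        · exact absurd (h ▸ hqe) hnot
        · exact h
      · intro q hq
        conv_rhs => rw [hdec]
        rw [padicValNat_pow_mul_of_ne hp (hpr' q hq) (hne q hq) _ hpos.ne']
    rcases Nat.lt_or_ge (padicValNat p a.natAbs) (padicValNat p e) with hU | hG
    · -- `U`-case
      have hU' : padicValNat p e = padicValNat p a.natAbs + 1 := by omega
      have hk : p ^ (padicValNat p a.natAbs + 1) ∣ e := hU' ▸ pow_padicValNat_dvd
      have hnot : ¬ p ∣ e / p ^ (padicValNat p a.natAbs + 1) := by
        intro h
        have : p ^ (padicValNat p e + 1) ∣ e := by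
          rw [hU', (Nat.mul_div_cancel' hk).symm, pow_succ]; exact mul_dvd_mul_left _ h
        exact pow_succ_padicValNat_not_dvd he.ne' this
      obtain ⟨hpos, hprimes', hval'⟩ := key _ hk hnot
      obtain ⟨ha'0, -, -⟩ := div_padic_facts hp ha
      refine red_cons_U hp hpps hpr' ha he hU' prof (ih hnd' hpr' _ ha'0 _ hpos hprimes' ?_ prof)
      intro q hq
      rw [hval' q hq, padicValNat_natAbs_div_of_ne hp (hpr' q hq) (hne q hq) ha]
      exact hbound q (List.mem_cons_of_mem p hq)
    · -- `G`-case
      have hk : p ^ padicValNat p e ∣ e := pow_padicValNat_dvd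
      have hnot : ¬ p ∣ e / p ^ padicValNat p e := by
        intro h
        have : p ^ (padicValNat p e + 1) ∣ e := by
          conv_rhs => rw [(Nat.mul_div_cancel' hk).symm]
          rw [pow_succ]; exact mul_dvd_mul_left _ h
        exact pow_succ_padicValNat_not_dvd he.ne' this
      obtain ⟨hpos, hprimes', hval'⟩ := key _ hk hnot
      refine red_cons_G hp hpps hpr' he hG prof (ih hnd' hpr' a ha _ hpos hprimes' ?_ prof)
      intro q hq
      rw [hval' q hq]
      exact hbound q (List.mem_cons_of_mem p hq)


/-! ### The switch `q ↔ s` with the coprimality condition `(q, al) = 1` -/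

/-- On the support of the congruence, `(q, al) = 1 ⇔ (q, a) = 1`: a common prime of `q` and `l`
would divide `lmn − a` and `lmn`, hence `a`. [folklore] -/
theorem coprime_mul_iff_of_dvd {a : ℤ} {q r l k : ℕ} (hlk : l ∣ k) (hdvd : ((q * r : ℕ) : ℤ) ∣ (k : ℤ) - a) :
    IsCoprime (q : ℤ) (a * l) ↔ Nat.Coprime q a.natAbs := by
  rw [Int.isCoprime_iff_nat_coprime, Int.natAbs_natCast, Int.natAbs_mul, Int.natAbs_natCast,
    Nat.coprime_mul_iff_right]
  constructor
  · exact fun h => h.1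
  · intro h
    refine ⟨h, ?_⟩
    rw [Nat.coprime_iff_gcd_eq_one]
    set g := Nat.gcd q l
    have hgq : g ∣ q := Nat.gcd_dvd_left q l
    have hgl : g ∣ l := Nat.gcd_dvd_right q l
    have h1 : (g : ℤ) ∣ (k : ℤ) - a :=
      (Int.natCast_dvd_natCast.2 (hgq.trans (dvd_mul_right q r))).trans hdvd
    have h2 : (g : ℤ) ∣ (k : ℤ) := Int.natCast_dvd_natCast.2 (hgl.trans hlk)
    have h3 : (g : ℤ) ∣ a := by have := dvd_sub h2 h1; rwa [sub_sub_cancel] at this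
    have h4 : g ∣ a.natAbs := Int.natCast_dvd.1 h3
    have h5 : g ∣ Nat.gcd q a.natAbs := Nat.dvd_gcd hgq h4
    rw [Nat.Coprime.gcd_eq_one h] at h5
    exact Nat.eq_one_of_dvd_one h5

/-- **The switch with an extra divisibility `d ∣ q`**: for `K ≥ 1`, `r, d ≥ 1` and `K ≤ S`,
`∑_{q ∈ (Q', 2Q']} [d ∣ q][qr ∣ K] = ∑_{s ≤ S} [d r s ∣ K ∧ Q'rs < K ≤ 2Q'rs]`.
[cite: BombieriFriedlanderIwaniecActa1986, §13 p. 241–242] -/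
theorem sum_Ioc_pdiv_dvd_eq {K : ℤ} (hK : 0 < K) {r d : ℕ} (hr : 0 < r) (hd : 0 < d) (Q' : ℕ) {S : ℕ}
    (hS : K ≤ S) :
    ∑ q ∈ Ioc Q' (2 * Q'), pdiv d q * (if ((q * r : ℕ) : ℤ) ∣ K then (1 : ℝ) else 0) =
      ∑ s ∈ Icc 1 S, (if ((d * (r * s) : ℕ) : ℤ) ∣ K ∧ (Q' : ℤ) * r * s < K ∧ K ≤ 2 * (Q' : ℤ) * r * s
        then (1 : ℝ) else 0) := by
  lift K to ℕ using hK.le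
  have hK0 : 0 < K := by exact_mod_cast hK
  have hSK : K ≤ S := by exact_mod_cast hS
  -- both sides are cardinalities
  have hL : ∑ q ∈ Ioc Q' (2 * Q'), pdiv d q * (if ((q * r : ℕ) : ℤ) ∣ (K : ℤ) then (1 : ℝ) else 0) =
      (((Ioc Q' (2 * Q')).filter (fun q : ℕ => d ∣ q ∧ q * r ∣ K)).card : ℝ) := by
    rw [← Finset.sum_boole]
    refine Finset.sum_congr rfl fun q _ => ?_
    unfold pdiv
    by_cases h1 : d ∣ q
    · by_cases h2 : q * r ∣ K
      · rw [if_pos h1, if_pos (Int.natCast_dvd_natCast.2 h2), if_pos ⟨h1, h2⟩, one_mul]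
      · rw [if_pos h1, if_neg (fun h => h2 (Int.natCast_dvd_natCast.1 h)), if_neg (fun h => h2 h.2),
          mul_zero]
    · rw [if_neg h1, zero_mul, if_neg (fun h => h1 h.1)]
  have hR : ∑ s ∈ Icc 1 S, (if ((d * (r * s) : ℕ) : ℤ) ∣ (K : ℤ) ∧ (Q' : ℤ) * r * s < K ∧
        (K : ℤ) ≤ 2 * (Q' : ℤ) * r * s then (1 : ℝ) else 0) =
      (((Icc 1 S).filter (fun s : ℕ => d * (r * s) ∣ K ∧ Q' * r * s < K ∧ K ≤ 2 * Q' * r * s)).card : ℝ) := by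
    rw [← Finset.sum_boole]
    refine Finset.sum_congr rfl fun s _ => ?_
    have e0 : (((d * (r * s) : ℕ) : ℤ) ∣ (K : ℤ)) ↔ d * (r * s) ∣ K := Int.natCast_dvd_natCast
    have e1 : ((Q' : ℤ) * r * s < K) ↔ (Q' * r * s < K) := by norm_cast
    have e2 : ((K : ℤ) ≤ 2 * (Q' : ℤ) * r * s) ↔ (K ≤ 2 * Q' * r * s) := by norm_cast
    simp only [e0, e1, e2]
  rw [hL, hR]
  congr 1
  refine Finset.card_bij' (fun q _ => K / (q * r)) (fun s _ => K / (r * s)) ?_ ?_ ?_ ?_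
  · -- maps into
    intro q hq
    rw [Finset.mem_filter, Finset.mem_Ioc] at hq
    obtain ⟨⟨hq1, hq2⟩, hdq, t, ht⟩ := hq
    have hq0 : 0 < q := by omega
    have hqr : 0 < q * r := Nat.mul_pos hq0 hr
    have ht0 : 0 < t := Nat.pos_of_ne_zero fun h => by rw [h, mul_zero] at ht; omega
    have hKq : K / (q * r) = t := by rw [ht, Nat.mul_div_cancel_left t hqr]
    rw [Finset.mem_filter, Finset.mem_Icc, hKq]
    refine ⟨⟨ht0, ?_⟩, ?_, ?_, ?_⟩
    · calc t ≤ q * r * t := Nat.le_mul_of_pos_left t hqr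
        _ = K := ht.symm
        _ ≤ S := hSK
    · obtain ⟨q', rfl⟩ := hdq
      exact ⟨q', by rw [ht]; ring⟩
    · rw [ht]
      exact Nat.mul_lt_mul_of_pos_right (Nat.mul_lt_mul_of_pos_right hq1 hr) ht0
    · rw [ht]
      gcongr
  · -- the inverse maps into
    intro s hs
    rw [Finset.mem_filter, Finset.mem_Icc] at hs
    obtain ⟨⟨hs1, _⟩, ⟨u, hu⟩, hw1, hw2⟩ := hs
    have hrs : 0 < r * s := Nat.mul_pos hr hs1
    have hKrs : K / (r * s) = d * u := by
      rw [hu, show d * (r * s) * u = (d * u) * (r * s) by ring, Nat.mul_div_cancel _ hrs]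
    rw [Finset.mem_filter, Finset.mem_Ioc, hKrs]
    refine ⟨⟨?_, ?_⟩, dvd_mul_right d u, ⟨s, by rw [hu]; ring⟩⟩
    · by_contra h
      push Not at h
      have : K ≤ Q' * r * s := by
        calc K = d * u * (r * s) := by rw [hu]; ring
          _ ≤ Q' * (r * s) := Nat.mul_le_mul_right _ h
          _ = Q' * r * s := by ring
      omega
    · by_contra h
      push Not at h
      have : 2 * Q' * r * s < K := by
        calc 2 * Q' * r * s = 2 * Q' * (r * s) := by ring
          _ < d * u * (r * s) := Nat.mul_lt_mul_of_pos_right h hrs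
          _ = K := by rw [hu]; ring
      omega
  · -- left inverse
    intro q hq
    rw [Finset.mem_filter, Finset.mem_Ioc] at hq
    obtain ⟨⟨hq1, _⟩, _, t, ht⟩ := hq
    have hq0 : 0 < q := by omega
    have hqr : 0 < q * r := Nat.mul_pos hq0 hr
    have ht0 : 0 < t := Nat.pos_of_ne_zero fun h => by rw [h, mul_zero] at ht; omega
    have hKq : K / (q * r) = t := by rw [ht, Nat.mul_div_cancel_left t hqr]
    rw [hKq, ht, show q * r * t = q * (r * t) by ring, Nat.mul_div_cancel _ (Nat.mul_pos hr ht0)]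
  · -- right inverse
    intro s hs
    rw [Finset.mem_filter, Finset.mem_Icc] at hs
    obtain ⟨⟨hs1, _⟩, ⟨u, hu⟩, _, _⟩ := hs
    have hrs : 0 < r * s := Nat.mul_pos hr hs1
    have hKrs : K / (r * s) = d * u := by
      rw [hu, show d * (r * s) * u = (d * u) * (r * s) by ring, Nat.mul_div_cancel _ hrs]
    have hu0 : 0 < u := Nat.pos_of_ne_zero fun h => by rw [h, mul_zero] at hu; omega
    have hdu : 0 < d * u := Nat.mul_pos hd hu0
    rw [hKrs, show K = d * u * r * s by rw [hu]; ring, show d * u * r * s = s * (d * u * r) by ring,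
      Nat.mul_div_cancel _ (Nat.mul_pos hdu hr)]

/-- **The `A`-part of a `q`-block, switched, with the coprimality condition removed by Möbius
inversion**: for `r, l ≥ 1`, a block `(Q', 2Q']` of `q`, ranges `SM, SN` of positive integers on
which `lmn > a` and `lmn − a ≤ S`,
`∑_{q ∈ (Q',2Q'], (q,al)=1} #ρρ{(m,n) : lmn ≡ a (qr)}
  = ∑_{d ∣ |a|} μ(d) ∑_{s ≤ S} gcount(a; SM, SN; l, l; d·r·s; a + Q'rs, a + 2Q'rs)`.
[cite: BombieriFriedlanderIwaniecActa1986, §13 p. 241–242; §14 p. 246] -/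
theorem sum_filter_coprime_setCongrCount_eq_moebius_switch {a : ℤ} (ha : a ≠ 0) (z : ℝ)
    {SM SN : Finset ℕ} {l r : ℕ} (hr : 0 < r) (Q' : ℕ) {S : ℕ}
    (hpos : ∀ m ∈ SM, ∀ n ∈ SN, a < ((l * m * n : ℕ) : ℤ))
    (hS : ∀ m ∈ SM, ∀ n ∈ SN, ((l * m * n : ℕ) : ℤ) - a ≤ S) :
    ∑ q ∈ (Ioc Q' (2 * Q')).filter (fun q : ℕ => IsCoprime (q : ℤ) (a * l)),
        setCongrCount a z SM SN l (q * r) =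
      ∑ d ∈ a.natAbs.divisors, (μ d : ℝ) *
        ∑ s ∈ Icc 1 S, gcount a z SM SN l l (d * (r * s)) (a + (Q' : ℤ) * r * s) (a + 2 * (Q' : ℤ) * r * s) := by
  have hA : a.natAbs ≠ 0 := Int.natAbs_ne_zero.2 ha
  -- write the left side with the indicator of the filter and put the `q`-sum inside
  rw [Finset.sum_filter]
  unfold setCongrCount gcount
  -- both sides as `∑_m ∑_n ρρ · (…)`
  have hLHS : ∑ q ∈ Ioc Q' (2 * Q'), (if IsCoprime (q : ℤ) (a * l) then
      ∑ m ∈ SM, ∑ n ∈ SN, (if ((l * m * n : ℕ) : ZMod (q * r)) = (a : ZMod (q * r)) then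
        roughIndicator z m * roughIndicator z n else 0) else 0) =
      ∑ m ∈ SM, ∑ n ∈ SN, (roughIndicator z m * roughIndicator z n) *
        ∑ q ∈ Ioc Q' (2 * Q'), (if IsCoprime (q : ℤ) (a * l) then (1 : ℝ) else 0) *
          (if ((q * r : ℕ) : ℤ) ∣ ((l * m * n : ℕ) : ℤ) - a then (1 : ℝ) else 0) := by
    have : ∀ q ∈ Ioc Q' (2 * Q'), (if IsCoprime (q : ℤ) (a * l) then
        ∑ m ∈ SM, ∑ n ∈ SN, (if ((l * m * n : ℕ) : ZMod (q * r)) = (a : ZMod (q * r)) then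
          roughIndicator z m * roughIndicator z n else 0) else 0) =
        ∑ m ∈ SM, ∑ n ∈ SN, (roughIndicator z m * roughIndicator z n) *
          ((if IsCoprime (q : ℤ) (a * l) then (1 : ℝ) else 0) *
            (if ((q * r : ℕ) : ℤ) ∣ ((l * m * n : ℕ) : ℤ) - a then (1 : ℝ) else 0)) := by
      intro q _
      by_cases hc : IsCoprime (q : ℤ) (a * l)
      · rw [if_pos hc]
        refine Finset.sum_congr rfl fun m _ => Finset.sum_congr rfl fun n _ => ?_
        rw [if_pos hc, one_mul]
        by_cases hd : ((l * m * n : ℕ) : ZMod (q * r)) = (a : ZMod (q * r))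
        · rw [if_pos hd, if_pos ((natCast_zmod_eq_iff_dvd a _ _).1 hd), mul_one]
        · rw [if_neg hd, if_neg (fun h => hd ((natCast_zmod_eq_iff_dvd a _ _).2 h)), mul_zero]
      · rw [if_neg hc]; symm
        exact Finset.sum_eq_zero fun m _ => Finset.sum_eq_zero fun n _ => by rw [if_neg hc]; ring
    rw [Finset.sum_congr rfl this, Finset.sum_comm]
    refine Finset.sum_congr rfl fun m _ => ?_
    rw [Finset.sum_comm]
    refine Finset.sum_congr rfl fun n _ => ?_
    rw [Finset.mul_sum]
  have hRHS : ∑ d ∈ a.natAbs.divisors, (μ d : ℝ) * ∑ s ∈ Icc 1 S, ∑ m ∈ SM, ∑ n ∈ SN,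
      dind (d * (r * s)) (l * m * n) a * wind (a + (Q' : ℤ) * r * s) (a + 2 * (Q' : ℤ) * r * s) (l * m * n) *
        (roughIndicator z m * roughIndicator z n) =
      ∑ m ∈ SM, ∑ n ∈ SN, (roughIndicator z m * roughIndicator z n) *
        ∑ d ∈ a.natAbs.divisors, (μ d : ℝ) * ∑ s ∈ Icc 1 S,
          dind (d * (r * s)) (l * m * n) a * wind (a + (Q' : ℤ) * r * s) (a + 2 * (Q' : ℤ) * r * s) (l * m * n) := by
    have : ∀ d ∈ a.natAbs.divisors, (μ d : ℝ) * ∑ s ∈ Icc 1 S, ∑ m ∈ SM, ∑ n ∈ SN,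
        dind (d * (r * s)) (l * m * n) a * wind (a + (Q' : ℤ) * r * s) (a + 2 * (Q' : ℤ) * r * s) (l * m * n) *
          (roughIndicator z m * roughIndicator z n) =
        ∑ m ∈ SM, ∑ n ∈ SN, (roughIndicator z m * roughIndicator z n) * ((μ d : ℝ) * ∑ s ∈ Icc 1 S,
          dind (d * (r * s)) (l * m * n) a * wind (a + (Q' : ℤ) * r * s) (a + 2 * (Q' : ℤ) * r * s) (l * m * n)) := by
      intro d _
      rw [Finset.sum_comm, Finset.mul_sum]
      refine Finset.sum_congr rfl fun m _ => ?_
      rw [Finset.sum_comm, Finset.mul_sum]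
      refine Finset.sum_congr rfl fun n _ => ?_
      rw [Finset.mul_sum, Finset.mul_sum, Finset.mul_sum]
      refine Finset.sum_congr rfl fun s _ => ?_
      ring
    rw [Finset.sum_congr rfl this, Finset.sum_comm]
    refine Finset.sum_congr rfl fun m _ => ?_
    rw [Finset.sum_comm]
    refine Finset.sum_congr rfl fun n _ => ?_
    rw [Finset.mul_sum]
  rw [hLHS, hRHS]
  refine Finset.sum_congr rfl fun m hm => Finset.sum_congr rfl fun n hn => ?_
  congr 1
  -- the identity for fixed `(m, n)`
  set K : ℤ := ((l * m * n : ℕ) : ℤ) - a with hKdef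
  have hK0 : 0 < K := by rw [hKdef]; linarith [hpos m hm n hn]
  have hKS : K ≤ S := hS m hm n hn
  -- Möbius on the coprimality indicator (only on the support)
  have step1 : ∀ q ∈ Ioc Q' (2 * Q'),
      (if IsCoprime (q : ℤ) (a * l) then (1 : ℝ) else 0) * (if ((q * r : ℕ) : ℤ) ∣ K then (1 : ℝ) else 0) =
      ∑ d ∈ a.natAbs.divisors, (μ d : ℝ) * (pdiv d q * (if ((q * r : ℕ) : ℤ) ∣ K then (1 : ℝ) else 0)) := by
    intro q hq
    have hq0 : q ≠ 0 := by rw [Finset.mem_Ioc] at hq; omega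
    by_cases hdvd : ((q * r : ℕ) : ℤ) ∣ K
    · rw [if_pos hdvd]
      have hlk : l ∣ l * m * n := ⟨m * n, by ring⟩
      have hiff := coprime_mul_iff_of_dvd hlk hdvd
      simp only [hiff, mul_one]
      rw [coprime_indicator_eq_sum_moebius hq0 hA, Finset.sum_filter]
      refine Finset.sum_congr rfl fun d _ => ?_
      unfold pdiv
      split_ifs <;> simp
    · rw [if_neg hdvd]; simp
  rw [Finset.sum_congr rfl step1, Finset.sum_comm]
  refine Finset.sum_congr rfl fun d hd => ?_
  rw [← Finset.mul_sum]
  congr 1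
  have hd0 : 0 < d := Nat.pos_of_mem_divisors hd
  rw [sum_Ioc_pdiv_dvd_eq hK0 hr hd0 Q' hKS]
  refine Finset.sum_congr rfl fun s _ => ?_
  unfold dind wind
  rw [← hKdef]
  have e1 : (a + (Q' : ℤ) * r * s < ((l * m * n : ℕ) : ℤ)) ↔ ((Q' : ℤ) * r * s < K) := by
    rw [hKdef]; constructor <;> intro h <;> linarith
  have e2 : (((l * m * n : ℕ) : ℤ) ≤ a + 2 * (Q' : ℤ) * r * s) ↔ (K ≤ 2 * (Q' : ℤ) * r * s) := by
    rw [hKdef]; constructor <;> intro h <;> linarith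
  simp only [e1, e2]
  by_cases h1 : ((d * (r * s) : ℕ) : ℤ) ∣ K
  · by_cases h2 : (Q' : ℤ) * r * s < K ∧ K ≤ 2 * (Q' : ℤ) * r * s
    · rw [if_pos h1, if_pos h2, if_pos ⟨h1, h2⟩, one_mul]
    · rw [if_pos h1, if_neg h2, if_neg (fun h => h2 h.2), mul_zero]
  · rw [if_neg h1, zero_mul, if_neg (fun h => h1 h.1)]

/-! ### Grouping the switched variable `s` by its part in a fixed `Θ` -/

/-- The multiples of `g` in `[1, S]` with `gcd(s, Θ) = g` are `g · {s' ≤ S/g : (s', Θ/g) = 1}`. [folklore] -/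
theorem filter_gcd_eq_image {Θ g : ℕ} (hΘ : 0 < Θ) (hg : g ∣ Θ) (S : ℕ) :
    (Icc 1 S).filter (fun s : ℕ => Nat.gcd s Θ = g) =
      ((Icc 1 (S / g)).filter (fun s' : ℕ => Nat.Coprime s' (Θ / g))).image (fun s' => g * s') := by
  have hg0 : 0 < g := Nat.pos_of_dvd_of_pos hg hΘ
  obtain ⟨Θ', hΘ'⟩ := hg
  have hΘg : Θ / g = Θ' := by rw [hΘ', Nat.mul_div_cancel_left _ hg0]
  ext s
  simp only [Finset.mem_filter, Finset.mem_Icc, Finset.mem_image]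
  constructor
  · rintro ⟨⟨hs1, hs2⟩, hgcd⟩
    have hgs : g ∣ s := hgcd ▸ Nat.gcd_dvd_left s Θ
    obtain ⟨s', rfl⟩ := hgs
    refine ⟨s', ⟨⟨?_, ?_⟩, ?_⟩, rfl⟩
    · rcases Nat.eq_zero_or_pos s' with h | h
      · rw [h, mul_zero] at hs1; omega
      · exact h
    · rw [Nat.le_div_iff_mul_le hg0, mul_comm]; exact hs2
    · rw [hΘg]
      rw [hΘ', Nat.gcd_mul_left] at hgcd
      rw [Nat.Coprime]
      have : g * Nat.gcd s' Θ' = g * 1 := by rw [mul_one]; exact hgcd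
      exact Nat.eq_of_mul_eq_mul_left hg0 this
  · rintro ⟨s', ⟨⟨hs1, hs2⟩, hcop⟩, rfl⟩
    refine ⟨⟨le_trans hg0 (Nat.le_mul_of_pos_right g hs1), ?_⟩, ?_⟩
    · rw [Nat.le_div_iff_mul_le hg0, mul_comm] at hs2; exact hs2
    · have hcop' : Nat.gcd s' Θ' = 1 := by rw [hΘg] at hcop; exact hcop
      rw [hΘ', Nat.gcd_mul_left, hcop', mul_one]

/-- **Grouping `s` by `gcd(s, Θ)`**: `∑_{s ≤ S} F(s) = ∑_{g ∣ Θ} ∑_{s' ≤ S/g, (s', Θ/g)=1} F(g s')`.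
[folklore] -/
theorem sum_Icc_eq_sum_divisors_gcd {Θ : ℕ} (hΘ : 0 < Θ) (S : ℕ) (F : ℕ → ℝ) :
    ∑ s ∈ Icc 1 S, F s =
      ∑ g ∈ Θ.divisors, ∑ s' ∈ (Icc 1 (S / g)).filter (fun s' : ℕ => Nat.Coprime s' (Θ / g)), F (g * s') := by
  have step1 : ∑ s ∈ Icc 1 S, F s = ∑ s ∈ Icc 1 S, ∑ g ∈ Θ.divisors, (if Nat.gcd s Θ = g then F s else 0) := by
    refine Finset.sum_congr rfl fun s _ => ?_
    rw [Finset.sum_ite_eq]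
    rw [if_pos]
    exact Nat.mem_divisors.2 ⟨Nat.gcd_dvd_right s Θ, hΘ.ne'⟩
  rw [step1, Finset.sum_comm]
  refine Finset.sum_congr rfl fun g hg => ?_
  rw [← Finset.sum_filter, filter_gcd_eq_image hΘ (Nat.dvd_of_mem_divisors hg) S, Finset.sum_image]
  intro x _ y _ h
  exact Nat.eq_of_mul_eq_mul_left (Nat.pos_of_mem_divisors hg) h

/-! ### Windows that are automatically satisfied -/

/-- If the window holds on the whole range, `gcount` is the plain congruence count `setCongrCount`
(with the congruence coefficient `lc` in the role of `l`). [folklore] -/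
theorem gcount_eq_setCongrCount_of_window (a : ℤ) (z : ℝ) {SM SN : Finset ℕ} (lc : ℕ) {L₀ : ℕ}
    (w : ℕ) {lo hi : ℤ} (hwin : ∀ m ∈ SM, ∀ n ∈ SN, lo < ((L₀ * m * n : ℕ) : ℤ) ∧ ((L₀ * m * n : ℕ) : ℤ) ≤ hi) :
    gcount a z SM SN lc L₀ w lo hi = setCongrCount a z SM SN lc w := by
  unfold gcount setCongrCount
  refine Finset.sum_congr rfl fun m hm => Finset.sum_congr rfl fun n hn => ?_
  unfold wind dind
  rw [if_pos (hwin m hm n hn), mul_one]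
  by_cases h : ((lc * m * n : ℕ) : ZMod w) = (a : ZMod w)
  · rw [if_pos h, if_pos ((natCast_zmod_eq_iff_dvd a _ _).1 h), one_mul]
  · rw [if_neg h, if_neg (fun h' => h ((natCast_zmod_eq_iff_dvd a _ _).2 h')), zero_mul]

/-- If the window fails on the whole range, `gcount = 0`. [folklore] -/
theorem gcount_eq_zero_of_window (a : ℤ) (z : ℝ) {SM SN : Finset ℕ} (lc : ℕ) {L₀ : ℕ} (w : ℕ)
    {lo hi : ℤ} (hwin : ∀ m ∈ SM, ∀ n ∈ SN, ¬ (lo < ((L₀ * m * n : ℕ) : ℤ) ∧ ((L₀ * m * n : ℕ) : ℤ) ≤ hi)) :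
    gcount a z SM SN lc L₀ w lo hi = 0 := by
  unfold gcount
  refine Finset.sum_eq_zero fun m hm => Finset.sum_eq_zero fun n hn => ?_
  unfold wind; rw [if_neg (hwin m hm n hn)]; ring

/-- If the window holds on the whole range and `(a·lc, w) = 1`, `gmodel` is the expected count
`setCoprimeCount/φ(w)` that `Δ*` subtracts. [folklore] -/
theorem gmodel_eq_setCoprimeCount_of_window {a : ℤ} (z : ℝ) {SM SN : Finset ℕ} {lc : ℕ} {L₀ : ℕ}
    {w : ℕ} (haw : Nat.Coprime a.natAbs w) (hlw : Nat.Coprime lc w) {lo hi : ℤ}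
    (hwin : ∀ m ∈ SM, ∀ n ∈ SN, lo < ((L₀ * m * n : ℕ) : ℤ) ∧ ((L₀ * m * n : ℕ) : ℤ) ≤ hi) :
    gmodel a z SM SN lc L₀ w lo hi = setCoprimeCount z SM SN w / (Nat.totient w : ℝ) := by
  unfold gmodel setCoprimeCount
  rw [Finset.sum_div]
  refine Finset.sum_congr rfl fun m hm => ?_
  rw [Finset.sum_div]
  refine Finset.sum_congr rfl fun n hn => ?_
  unfold wind
  rw [if_pos (hwin m hm n hn), mul_one, pmodel_of_coprime haw]
  have : (lc * m * n).Coprime w ↔ (m * n).Coprime w := by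
    rw [mul_assoc, Nat.coprime_mul_iff_left]
    exact ⟨fun h => h.2, fun h => ⟨hlw, h⟩⟩
  simp only [this]
  by_cases h : (m * n).Coprime w
  · rw [if_pos h, if_pos h]; field_simp
  · rw [if_neg h, if_neg h]; simp

/-- If the window fails on the whole range, `gmodel = 0`. [folklore] -/
theorem gmodel_eq_zero_of_window (a : ℤ) (z : ℝ) {SM SN : Finset ℕ} (lc : ℕ) {L₀ : ℕ} (w : ℕ)
    {lo hi : ℤ} (hwin : ∀ m ∈ SM, ∀ n ∈ SN, ¬ (lo < ((L₀ * m * n : ℕ) : ℤ) ∧ ((L₀ * m * n : ℕ) : ℤ) ≤ hi)) :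
    gmodel a z SM SN lc L₀ w lo hi = 0 := by
  unfold gmodel
  refine Finset.sum_eq_zero fun m hm => Finset.sum_eq_zero fun n hn => ?_
  unfold wind; rw [if_neg (hwin m hm n hn)]; ring

end BFI

end Literature.NumberTheory.Sieve
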